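import Mathlib.Analysis.Convex.Jensen
import Mathlib.Analysis.Convex.SpecificFunctions.Basic
import Mathlib.Analysis.SpecialFunctions.Log.Base
import Literature.InformationTheory.Entropy.MapEntropy
import Literature.Computability.Cryptography.LiuPassWeakOWF
import Literature.Computability.Cryptography.Indistinguishability
import HarnessLib

/-!
# Liu–Pass, Thm 5.2: mild average-case `K^t`-hardness from conditionally secure entropy-preserving PRGs

D-0014 companion (level 2) of `Sweep1Proofs.lean` / `LiuPassWeakOWF.lean` for the named fact
`Literature.Computability.Cryptography.OWFExist_iff_isMildlyHardOnAverage_liuPassKt` (crypto-foundations.S02,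
Liu–Pass FOCS 2020, Thm 1.1), direction `→` ("mild avg-case `K^t`-hardness from OWFs", §5 of
arXiv:2009.11514). It **defines** Liu–Pass's conditionally-secure entropy-preserving PRGs
(Def 5.1) and **proves** their Thm 5.2 — cond EP-PRGs whose outputs have low `K^t`-complexity make
`K^t` mildly hard-on-average — for the tree's abstract efficient universal machine
`Literature.Computability.MetaComplexity.UniversalMachine`, down to one efficiency claim (the distinguisher is PPT), and
records the input from §5.3 (cond EP-PRGs from OWFs, Thms 5.5–5.6) as a named fact:

* `mapEntropy S f` — Shannon entropy of `f(U_S)` (§2.6), with the reverse-Markov averaging step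
  (`card_le_mul_card_filter_of_le_sum`), the entropy drop under maps with small fibres
  (`mapEntropy_sub_le_mapEntropy_comp`, Jensen) and the counting core of Claim 2
  (`card_filter_div_card_le_of_mapEntropy`).  Since 2026-08-15 these are PROVED in the
  Mathlib-only `Literature/InformationTheory/Entropy/MapEntropy.lean`
  (`Literature.InformationTheory.Entropy.mapEntropy`, requested by route PneNP/SzkEntropy so that
  `PEA`/`PED` need not import this file's cryptographic cone); this file keeps the two
  definitions `fiber`/`mapEntropy` with VERBATIM bodies (a dozen cryptography files `unfold` them;
  `fiber_eq_entropyFiber`/`mapEntropy_eq_entropyMapEntropy : … = … := rfl`) and its lemmas as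
  one-line aliases, plus aliases `mapEntropy_comp_of_injOn/univ_comp_equiv/product/of_injective/
  const` of the invariance/additivity rules;
* `IsCondEPPRG μ G E ℓ α` — Def 5.1 (`condUniform`, `condEnsemble` = `G(U_n | E_n)`);
* `card_filter_liuPassKt_lt` — "a random string has high `K^t`-complexity" (fewer than `2^k`
  strings of length `m` have `K^t < k`, from `UniversalMachine.ncard_setOf_ktAt_lt`);
* `liuPassDist ℋ ℓ` — the distinguisher `𝒜(1ⁿ, x) = [ℋ(x) ≥ m - 3⌊log₂ n⌋]` of the proof of
  Thm 5.2, with the efficiency fact `liuPassDistRun_polyTime` and `isPPT_liuPassDist`;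
* `avgSuccessProb_sub_le_uniformAvg` (Claim 1), `sum_pr_liuPassDist_div_card_le` (Claim 2, in
  expectation form) and `inv_sq_le_advantage` (advantage `≥ 1/n²` at one large `n`);
* `isMildlyHardOnAverage_liuPassKt_of_family` — **Thm 5.2** for a finite covering family of
  `1/n²`-cond EP-PRGs with low-`K^t` outputs (`exists_length_eq_trunc`: the lengths
  `n + γ⌊log₂ n⌋ - c`, `c ≤ γ + 1`, cover every `m`);
* `condEPPRG_family_of_OWFExist` — named fact: what the proof of Thm 5.2 takes from §5.3 and §2.2
  (Thm 5.6, the truncations `G^c`, and eq. (2) `K^t(G(s)) ≤ m - γ/2 log n`), for the tree's `U`;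
* `isMildlyHardOnAverage_liuPassKt_of_OWFExist_of` — S02 `→` for every `U` and every polynomial
  `t(n) ≥ (1+ε)n` from the two facts; `exists_isMildlyHardOnAverage_liuPassKt_of_OWFExist_of` —
  the level-1 fact of `Sweep1Proofs.lean` (Thm 3.1 (a) ⇒ (b)) from the same;
  `OWFExist_iff_isMildlyHardOnAverage_liuPassKt_of_facts` — **S02 from five named facts** (two
  efficiency facts of Thm 4.1, Yao's amplification S05, the §5.3 fact, the efficiency fact of
  Thm 5.2), everything else being proved in `LiuPassWeakOWF.lean` and here.

## Deviations from print (all documented at the declarations)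

1. *Expectation instead of good coins (Claim 2).* Print fixes a good random tape of `ℋ` by Markov
   and counts the set `S` of accepted good outputs; we bound `Pr[𝒜 accepts G(U_n|E_n)]` linearly by
   `a/(a+1) + 2^{a+1-n} · 2^m · Pr[ℋ fails on U_m]` (`a = α log₂ n`), which is the same argument
   averaged over the tape. The resulting hardness polynomial is `p(m) = m^{α+γ+3} + 1` (print:
   `2 m^{2(α+γ+1)}`), and the advantage bound is `1/(α log₂ n + 1) - 11/n³ ≥ 1/n²` (print:
   `1/n - 4/n² ≥ 1/n²`).
2. *Threshold.* Print's `𝒜` accepts iff `ℋ(x) ≥ m - (3γ/8) log n` with `γ ≥ 8`; we use the integer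
   threshold `m - 3⌊log₂ n⌋` (`lpThr`), i.e. print's with `γ = 8`, and ask of the generator only
   `K^t(G(s)) + 3⌊log₂ n⌋ < m` (print's eq. (2) gives `K^t(G(s)) ≤ m - γ/2 log n`).
3. *Coins of `𝒜`.* In the tree's `RandAlg` model coin budgets are indexed by the input length; `𝒜`
   on `⟨1ⁿ, x⟩` uses exactly `ℋ`'s budget on `|x| = ℓ(n)`-bit inputs (`lpSeedOf` recovers `n` from
   `2n + 2 + ℓ(n)`, which is injective for monotone `ℓ`), so `ℋ` is run on correctly distributed
   coins and no coin-length computation is needed inside `𝒜`.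
4. *The universal machine.* Print's eq. (2) uses rate-1 efficiency of `G` and the convention (§2.2)
   that the budget of `U(Π, 1^t)` counts the emulated machine's steps; for the tree's abstract `U`
   (polynomial simulation overhead, `UniversalMachine.sim`) the low-`K^t` property of the
   generator's outputs is kept as an explicit hypothesis of Thm 5.2 (`hK`) and enters the named
   fact `condEPPRG_family_of_OWFExist`, whose docstring explains how print's padded generator of
   Thm 5.6 provides it.

5. *Exact hardness only.* Print's Thm 5.2 concludes that `K^t` is mildly hard-on-average to
   `(d log n)`-**approximate** for every constant `d` (using `γ ≥ max(8, 8d)`);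
   `isMildlyHardOnAverage_liuPassKt_of_family` proves mild hardness of computing `K^t` **exactly**
   (Claim 1 with exact success, the case `d = 0`), which is what S02 (`IsMildlyHardOnAverage`)
   asks for but is weaker than the printed theorem.

Theorem numbering follows arXiv:2009.11514v1 (Def 5.1 = §5.1, Thm 5.2 = §5.2 with Claims 1–2,
Lemmas 5.3–5.4 and Thms 5.5–5.6 = §5.3, Lemma 2.x = §2.6, Thm 3.1 = §3, Thm 1.1).

## References

* Y. Liu, R. Pass, *On one-way functions and Kolmogorov complexity*, FOCS 2020, 1243–1254;
  arXiv:2009.11514, §2.5–2.6, §5.1 (Def 5.1), §5.2 (Thm 5.2 and its proof), §5.3 (Thms 5.5–5.6),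
  §3 (Thm 3.1 and the remark following it), Thm 1.1. doi:10.1109/FOCS46700.2020.00118
* O. Goldreich, *Foundations of Cryptography I*, CUP 2001, Def. 3.2.2 (distinguishers).
* T. M. Cover, J. A. Thomas, *Elements of Information Theory*, 2nd ed., Wiley 2006, (2.1)–(2.3),
  (2.14), Problem 2.4 (entropy of a function of a random variable).
* S. Arora, B. Barak, *Computational Complexity: A Modern Approach*, CUP 2009, Thm 1.9, §7.1.
-/

namespace Literature.Computability.Cryptography

open Filter _root_.Computability Complexity MetaComplexity Finset
open scoped ENNReal

/-! ### Shannon entropy of the image of a uniform distribution on a finite set -/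

section Entropy

variable {ι β β' : Type*} [DecidableEq β] [DecidableEq β']

/-- The fibre of `f` over `y` inside the finite set `S`: `{w ∈ S | f w = y}`. Same body as (hence
definitionally equal to, `fiber_eq_entropyFiber`) `Literature.InformationTheory.Entropy.fiber`;
kept here because the cryptography files importing this one unfold it. [folklore] -/
def fiber (S : Finset ι) (f : ι → β) (y : β) : Finset ι :=
  S.filter fun w => f w = y

/-- Membership in a fibre, unfolded. [folklore] -/
@[simp] theorem mem_fiber {S : Finset ι} {f : ι → β} {y : β} {w : ι} :
    w ∈ fiber S f y ↔ w ∈ S ∧ f w = y := by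
  simp [fiber]

/-- A fibre is a subset of the ambient finite set. [folklore] -/
theorem fiber_subset (S : Finset ι) (f : ι → β) (y : β) : fiber S f y ⊆ S :=
  Finset.filter_subset _ _

/-- Every point of `S` lies in its own fibre. [folklore] -/
theorem self_mem_fiber {S : Finset ι} (f : ι → β) {v : ι} (hv : v ∈ S) : v ∈ fiber S f (f v) :=
  mem_fiber.2 ⟨hv, rfl⟩

/-- The fibre through a point of `S` is nonempty, so has positive cardinality. [folklore] -/
theorem card_fiber_pos {S : Finset ι} (f : ι → β) {v : ι} (hv : v ∈ S) :
    0 < (fiber S f (f v)).card :=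
  Finset.card_pos.2 ⟨v, self_mem_fiber f hv⟩

/-- A fibre is at most as large as `S`. [folklore] -/
theorem card_fiber_le (S : Finset ι) (f : ι → β) (y : β) : (fiber S f y).card ≤ S.card :=
  Finset.card_le_card (fiber_subset S f y)

/-- **Shannon entropy of `f(U_S)`**, the image under `f` of the uniform distribution on the finite
set `S`, in bits, written in the "expected surprise" form
`H(f(U_S)) = E_{v ← S}[log₂ (1 / Pr[f(U_S) = f(v)])] = (1/|S|) ∑_{v ∈ S} log₂ (|S| / |f⁻¹(f v) ∩ S|)`
(Liu–Pass: "`H(X) = E[log 1/Pr[X = x]]`"). Equal to the familiar `∑_y p_y log₂ (1/p_y)` over the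
image (`mapEntropy_eq_sum_image`), i.e. `mapEntropy S f` is the tree's
`Literature.Computability.AlgebraicComplexity.shannonEntropy` (`AlgebraicComplexity/QuantumFunctionals.lean`, on a `Fintype`) of the
image distribution `y ↦ |f⁻¹(y) ∩ S| / |S|` on the subtype `S.image f` (not imported here to keep the
import closure small; unification note for a librarian). Junk value `0` for `S = ∅`. Same body as
(hence definitionally equal to, `mapEntropy_eq_entropyMapEntropy`)
`Literature.InformationTheory.Entropy.mapEntropy` (the Mathlib-only home of this notion and of the
proofs of the lemmas below); kept here because a dozen cryptography files `unfold mapEntropy`.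
[Y. Liu, R. Pass, FOCS 2020, §2.6;
T. Cover, J. Thomas, *Elements of Information Theory*, 2nd ed., (2.1)–(2.3)]
[cite: LiuPassFOCS2020, §2.6] -/
noncomputable def mapEntropy (S : Finset ι) (f : ι → β) : ℝ :=
  (∑ v ∈ S, Real.logb 2 ((S.card : ℝ) / (fiber S f (f v)).card)) / S.card

/-- `mapEntropy` is the Shannon entropy `∑_{y ∈ f(S)} p_y log₂ (1/p_y)` of the image distribution
`p_y = |f⁻¹(y) ∩ S| / |S|` (grouping the expectation by fibres). [Cover–Thomas, (2.1)–(2.3)]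
[folklore] -/
theorem mapEntropy_eq_sum_image (S : Finset ι) (f : ι → β) :
    mapEntropy S f = ∑ y ∈ S.image f,
      ((fiber S f y).card : ℝ) / S.card * Real.logb 2 ((S.card : ℝ) / (fiber S f y).card) :=
  Literature.InformationTheory.Entropy.mapEntropy_eq_sum_image S f

/-- The surprise of every outcome is at most `log₂ |S|` (min-entropy at most `log₂ |S|`): for
`v ∈ S`, `log₂ (|S| / |f⁻¹(f v) ∩ S|) ≤ log₂ |S|`. [Y. Liu, R. Pass, FOCS 2020, proof of Thm 5.2
("`-log Pr[G(U_n | E_n) = y]` is upper bounded by `n`")] [cite: LiuPassFOCS2020, Thm 5.2 (proof)] -/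
theorem logb_card_div_card_fiber_le {S : Finset ι} (f : ι → β) {v : ι} (hv : v ∈ S) :
    Real.logb 2 ((S.card : ℝ) / (fiber S f (f v)).card) ≤ Real.logb 2 S.card :=
  Literature.InformationTheory.Entropy.logb_card_div_card_fiber_le f hv

/-- The surprise of every outcome is nonnegative: `0 ≤ log₂ (|S| / |f⁻¹(f v) ∩ S|)`. [folklore] -/
theorem logb_card_div_card_fiber_nonneg {S : Finset ι} (f : ι → β) {v : ι} (hv : v ∈ S) :
    0 ≤ Real.logb 2 ((S.card : ℝ) / (fiber S f (f v)).card) :=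
  Literature.InformationTheory.Entropy.logb_card_div_card_fiber_nonneg f hv

/-- **Reverse Markov inequality** (the averaging step of Liu–Pass's Claim 2). If `X ≤ N` on the
nonempty finite set `S` and the average of `X` over `S` is at least `N - a` (`a ≥ 0`), then at
least a `1/(a+1)` fraction of the points of `S` have `X ≥ N - a - 1`:
`|S| ≤ (a + 1) · |{v ∈ S | X v ≥ N - a - 1}|` (no sign condition on `a` is needed). (Print states
the fraction as `1/n`, using `a + 1 = α log n + 1 ≤ n`.) [Y. Liu, R. Pass, FOCS 2020, proof of Thm 5.2, Claim 2 ("By an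
averaging argument, with probability at least `1/n` …")] [cite: LiuPassFOCS2020, Thm 5.2 (proof, Claim 2)] -/
theorem card_le_mul_card_filter_of_le_sum {S : Finset ι} {X : ι → ℝ} {N a : ℝ}
    (hX : ∀ v ∈ S, X v ≤ N) (hsum : (N - a) * S.card ≤ ∑ v ∈ S, X v) :
    (S.card : ℝ) ≤ (a + 1) * (S.filter fun v => N - a - 1 ≤ X v).card :=
  Literature.InformationTheory.Entropy.card_le_mul_card_filter_of_le_sum hX hsum

/-- **Entropy drops by at most `c` bits under a map with fibres of size `≤ 2^c` on the image**
(used for Liu–Pass's truncated generators `G^c`: "`G^c` is also a cond EP-PRG"). If every fibre of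
`g` restricted to `f(S)` has at most `2^c` elements then `H(g(f(U_S))) ≥ H(f(U_S)) - c`. Proof:
`H(f U_S) - H(g f U_S) = E_v[log₂ (|fibre of g∘f through v| / |fibre of f through v|)]
≤ log₂ E_v[…]` (Jensen) and the expectation equals `(1/|S|) ∑_{y ∈ f(S)} |(g∘f)⁻¹(g y) ∩ S| ≤ 2^c`.
[Y. Liu, R. Pass, FOCS 2020, proof of Thm 5.2 (first paragraph, the truncations `G^c`);
Cover–Thomas, 2nd ed., (2.14) and Problem 2.4 (`H(g(X)) ≥ H(X) - H(X | g(X))`)]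
[cite: LiuPassFOCS2020, Thm 5.2 (proof)] -/
theorem mapEntropy_sub_le_mapEntropy_comp {S : Finset ι} (hS : S.Nonempty) (f : ι → β) (g : β → β')
    (c : ℕ) (hg : ∀ z, ((S.image f).filter fun y => g y = z).card ≤ 2 ^ c) :
    mapEntropy S f - c ≤ mapEntropy S (g ∘ f) :=
  Literature.InformationTheory.Entropy.mapEntropy_sub_le_mapEntropy_comp hS f g c hg

/-- Under `|S| ≤ 2^n` every surprise is at most `n` (print: "`-log Pr[G(U_n|E_n) = y]` is upper
bounded by `n` since `H_∞(G(U_n|E_n)) ≤ H_∞(U_n|E_n) ≤ H_∞(U_n) = n`").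
[Y. Liu, R. Pass, FOCS 2020, proof of Thm 5.2, Claim 2] [cite: LiuPassFOCS2020, Thm 5.2 (proof, Claim 2)] -/
theorem logb_card_div_card_fiber_le_of_card_le {S : Finset ι} (f : ι → β) {v : ι} (hv : v ∈ S)
    {n : ℕ} (hn : S.card ≤ 2 ^ n) :
    Real.logb 2 ((S.card : ℝ) / (fiber S f (f v)).card) ≤ n :=
  Literature.InformationTheory.Entropy.logb_card_div_card_fiber_le_of_card_le f hv hn

/-- **The counting core of Liu–Pass's Claim 2** (proof of Thm 5.2), in linear form. Let `S` be a
nonempty finite set (the conditioning event), `f` a map on it (the generator), and suppose every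
surprise `log₂ (|S| / |f⁻¹(f v) ∩ S|)` is at most `n` while their average — the Shannon entropy
`H(f(U_S))` — is at least `n - a` (`a ≥ 0`). Then for every property `Q` of outputs, the
probability that `f(U_S)` satisfies `Q` is at most `a/(a+1)` (the mass of "bad" seeds, whose
output has surprise `< n - a - 1`, by the reverse Markov inequality) plus `2^{a+1-n}` times the
*number* of outputs satisfying `Q` (each "good" output has probability `≤ 2^{-(n-a-1)}`):
`Pr_{v ← S}[Q(f v)] ≤ a/(a+1) + 2^{a+1-n} · #{y ∈ f(S) | Q y}`. Print applies this with `Q` =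
"the deterministic distinguisher `A_r` accepts", `a = α log n`. [Y. Liu, R. Pass, FOCS 2020,
proof of Thm 5.2, Claim 2; arXiv:2009.11514, §5.2] [cite: LiuPassFOCS2020, Thm 5.2 (proof, Claim 2)] -/
theorem card_filter_div_card_le_of_mapEntropy {S : Finset ι} (hS : S.Nonempty) (f : ι → β)
    {n a : ℝ} (ha : 0 ≤ a)
    (hX : ∀ v ∈ S, Real.logb 2 ((S.card : ℝ) / (fiber S f (f v)).card) ≤ n)
    (hH : n - a ≤ mapEntropy S f) (Q : β → Prop) [DecidablePred Q] :
    ((S.filter fun v => Q (f v)).card : ℝ) / S.card ≤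
      a / (a + 1) + (2 : ℝ) ^ (a + 1 - n) * ((S.image f).filter Q).card :=
  Literature.InformationTheory.Entropy.card_filter_div_card_le_of_mapEntropy hS f ha hX hH Q

/-! #### Bridge to `Literature/InformationTheory/Entropy/MapEntropy.lean` -/

/-- This file's `fiber` is, by `rfl`, the information-theory tree's
`Literature.InformationTheory.Entropy.fiber` (same body). [folklore] -/
theorem fiber_eq_entropyFiber (S : Finset ι) (f : ι → β) :
    fiber S f = Literature.InformationTheory.Entropy.fiber S f := rfl

/-- This file's `mapEntropy` is, by `rfl`, `Literature.InformationTheory.Entropy.mapEntropy` (same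
body): any lemma of `Literature/InformationTheory/Entropy/MapEntropy.lean` transports along this
equation. [folklore] -/
theorem mapEntropy_eq_entropyMapEntropy (S : Finset ι) (f : ι → β) :
    mapEntropy S f = Literature.InformationTheory.Entropy.mapEntropy S f := rfl

/-- **Entropy is invariant under post-composition with a map injective on the outputs**:
if `g (f a) = g (f b) → f a = f b` for `a, b ∈ S` then `H(g(f(U_S))) = H(f(U_S))`.  Alias of
`Literature.InformationTheory.Entropy.mapEntropy_comp_of_injOn` for this file's `mapEntropy`.
[Cover–Thomas, 2nd ed., Problem 2.4] [folklore] -/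
theorem mapEntropy_comp_of_injOn {S : Finset ι} (f : ι → β) (g : β → β')
    (hg : ∀ a ∈ S, ∀ b ∈ S, g (f a) = g (f b) → f a = f b) :
    mapEntropy S (g ∘ f) = mapEntropy S f :=
  Literature.InformationTheory.Entropy.mapEntropy_comp_of_injOn f g hg

/-- **Entropy is invariant under re-indexing the sample space** along an equivalence
`e : ι' ≃ ι`: `H((f ∘ e)(U_{ι'})) = H(f(U_ι))`.  Alias of
`Literature.InformationTheory.Entropy.mapEntropy_univ_comp_equiv`. [folklore] -/
theorem mapEntropy_univ_comp_equiv {ι' : Type*} [Fintype ι] [Fintype ι'] (e : ι' ≃ ι) (f : ι → β) :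
    mapEntropy Finset.univ (f ∘ e) = mapEntropy Finset.univ f :=
  Literature.InformationTheory.Entropy.mapEntropy_univ_comp_equiv e f

/-- **Entropy is additive on independent pairs**: for nonempty `S, T`,
`H((f × g)(U_{S × T})) = H(f(U_S)) + H(g(U_T))`.  Alias of
`Literature.InformationTheory.Entropy.mapEntropy_product`. [Cover–Thomas, 2nd ed., Thm 2.6.6;
DGRV 2010, §3 p. 6] [cite: DvirGutfreundRothblumVadhan2010, §3 p.6] -/
theorem mapEntropy_product {ι' : Type*} {S : Finset ι} {T : Finset ι'} (hS : S.Nonempty)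
    (hT : T.Nonempty) (f : ι → β) (g : ι' → β') :
    mapEntropy (S ×ˢ T) (Prod.map f g) = mapEntropy S f + mapEntropy T g :=
  Literature.InformationTheory.Entropy.mapEntropy_product hS hT f g

/-- The image of a uniform distribution under an injective map is flat on `|S|` points:
`H(f(U_S)) = log₂ |S|`.  Alias of `Literature.InformationTheory.Entropy.mapEntropy_of_injective`.
[DGRV 2010, Claim 2.2] [cite: DvirGutfreundRothblumVadhan2010, Claim 2.2] -/
theorem mapEntropy_of_injective (S : Finset ι) {f : ι → β} (hf : Function.Injective f) :
    mapEntropy S f = Real.logb 2 S.card :=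
  Literature.InformationTheory.Entropy.mapEntropy_of_injective S hf

/-- A constant map has output entropy `0`.  Alias of
`Literature.InformationTheory.Entropy.mapEntropy_const`. [DGRV 2010, Claim 2.2]
[cite: DvirGutfreundRothblumVadhan2010, Claim 2.2] -/
theorem mapEntropy_const (S : Finset ι) (c : β) : mapEntropy S (fun _ : ι => c) = 0 :=
  Literature.InformationTheory.Entropy.mapEntropy_const S c

end Entropy

/-! ### Conditioned uniform distributions and Liu–Pass's cond EP-PRGs (Def 5.1) -/

section CondEPPRG

/-- The uniform distribution on a finite set `S` of strings ("`U_n | E_n`" for `S = E_n ⊆ {0,1}^n`),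
with junk value `δ_[]` when `S = ∅`. [Y. Liu, R. Pass, FOCS 2020, §5.1 (`G(U_n | E_n)`)]
[cite: LiuPassFOCS2020, Def 5.1] -/
noncomputable def condUniform (S : Finset (List Bool)) : PMF (List Bool) :=
  if h : S.Nonempty then PMF.uniformOfFinset S h else PMF.pure []

/-- On a nonempty set, `condUniform` is Mathlib's `PMF.uniformOfFinset`. [folklore] -/
theorem condUniform_eq {S : Finset (List Bool)} (h : S.Nonempty) :
    condUniform S = PMF.uniformOfFinset S h := by
  simp [condUniform, h]

/-- The ensemble `n ↦ G(U_n | E_n)`: the generator applied to a uniform seed conditioned on the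
event `E_n`. [Y. Liu, R. Pass, FOCS 2020, Def 5.1] [cite: LiuPassFOCS2020, Def 5.1] -/
noncomputable def condEnsemble (G : List Bool → List Bool) (E : ℕ → Finset (List Bool)) :
    Ensemble (List Bool) :=
  fun n => (condUniform (E n)).map G

/-- **Liu–Pass's conditionally-secure entropy-preserving PRG** (FOCS 2020, Def 5.1 =
arXiv:2009.11514 §5.1). `IsCondEPPRG μ G E ℓ α`: the efficiently computable
`G : {0,1}^n → {0,1}^{ℓ(n)}` together with the events `E_n ⊆ {0,1}^n` (nonempty, so that
conditioning makes sense) and the entropy-loss constant `α` satisfy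
* (pseudorandomness) `{G(U_n | E_n)}` and `{U_{ℓ(n)}}` are `μ(n)`-indistinguishable: every PPT
  distinguisher `D` has `|Pr[D(1ⁿ, G(U_n|E_n)) = 1] - Pr[D(1ⁿ, U_{ℓ n}) = 1]| < μ(n)` for all
  sufficiently large `n` (§2.5);
* (entropy-preserving) `H(G(U_n | E_n)) ≥ n - α log₂ n` for all sufficiently large `n`
  (Shannon entropy, `mapEntropy`).
Rendering: `G` is a function on all strings, required to be polynomial-time
(`PolyTimeComputable`) and to have output length `ℓ(n)` on `{0,1}^n` for all large `n` (print
writes the codomain `{0,1}^{n + γ log n}` into the type; the stretch is kept as the separate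
parameter `ℓ`); `α` is a natural number (print: "a constant"; the condition is monotone in `α`).
Print's "rate-1 efficiency" is a separate notion not recorded here.
[Y. Liu, R. Pass, FOCS 2020, Def 5.1 and §2.5; arXiv:2009.11514, §5.1] [cite: LiuPassFOCS2020, Def 5.1] -/
def IsCondEPPRG (μ : ℕ → ℝ) (G : List Bool → List Bool) (E : ℕ → Finset (List Bool)) (ℓ : ℕ → ℕ)
    (α : ℕ) : Prop :=
  PolyTimeComputable id id G ∧
  (∀ n, (E n).Nonempty ∧ ∀ s ∈ E n, s.length = n) ∧
  (∀ᶠ n in atTop, ∀ s : List Bool, s.length = n → (G s).length = ℓ n) ∧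
  (∀ D : RandAlg (List Bool) Bool, IsPPT D encodeBool →
    ∀ᶠ n in atTop, distAdvantage D (condEnsemble G E) (uniformEnsemble ℓ) n < μ n) ∧
  (∀ᶠ n : ℕ in atTop, (n : ℝ) - α * Real.logb 2 n ≤ mapEntropy (E n) G)

namespace IsCondEPPRG

variable {μ : ℕ → ℝ} {G : List Bool → List Bool} {E : ℕ → Finset (List Bool)} {ℓ : ℕ → ℕ} {α : ℕ}

/-- A cond EP-PRG is polynomial-time computable (projection). [cite: LiuPassFOCS2020, Def 5.1] -/
theorem polyTimeComputable (h : IsCondEPPRG μ G E ℓ α) : PolyTimeComputable id id G := h.1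

/-- The conditioning events are nonempty (projection). [cite: LiuPassFOCS2020, Def 5.1] -/
theorem nonempty (h : IsCondEPPRG μ G E ℓ α) (n : ℕ) : (E n).Nonempty := (h.2.1 n).1

/-- The conditioning events consist of `n`-bit strings (projection). [cite: LiuPassFOCS2020, Def 5.1] -/
theorem length_eq (h : IsCondEPPRG μ G E ℓ α) {n : ℕ} {s : List Bool} (hs : s ∈ E n) :
    s.length = n := (h.2.1 n).2 s hs

/-- Output length `ℓ(n)` on `n`-bit seeds, eventually (projection). [cite: LiuPassFOCS2020, Def 5.1] -/
theorem length_out (h : IsCondEPPRG μ G E ℓ α) :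
    ∀ᶠ n in atTop, ∀ s : List Bool, s.length = n → (G s).length = ℓ n := h.2.2.1

/-- Pseudorandomness against a PPT distinguisher (projection). [cite: LiuPassFOCS2020, Def 5.1] -/
theorem pseudorandom (h : IsCondEPPRG μ G E ℓ α) {D : RandAlg (List Bool) Bool}
    (hD : IsPPT D encodeBool) :
    ∀ᶠ n in atTop, distAdvantage D (condEnsemble G E) (uniformEnsemble ℓ) n < μ n :=
  h.2.2.2.1 D hD

/-- Entropy preservation (projection). [cite: LiuPassFOCS2020, Def 5.1] -/
theorem entropy (h : IsCondEPPRG μ G E ℓ α) :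
    ∀ᶠ n : ℕ in atTop, (n : ℝ) - α * Real.logb 2 n ≤ mapEntropy (E n) G := h.2.2.2.2

/-- The entropy-loss constant may be enlarged. [cite: LiuPassFOCS2020, Def 5.1] -/
theorem mono (h : IsCondEPPRG μ G E ℓ α) {α' : ℕ} (hα : α ≤ α') : IsCondEPPRG μ G E ℓ α' := by
  refine ⟨h.1, h.2.1, h.2.2.1, h.2.2.2.1, ?_⟩
  filter_upwards [h.entropy, eventually_ge_atTop 1] with n hn h1
  have hlog : 0 ≤ Real.logb 2 n := Real.logb_nonneg (by norm_num) (by exact_mod_cast h1)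
  have : (α : ℝ) * Real.logb 2 n ≤ α' * Real.logb 2 n :=
    mul_le_mul_of_nonneg_right (by exact_mod_cast hα) hlog
  linarith

end IsCondEPPRG

/-! ### Acceptance probabilities as finite averages -/

/-- `Pr[D(z) = 1]` is the value of the output distribution at `true`. [folklore] -/
theorem pr_true_eq_toReal (D : RandAlg (List Bool) Bool) (z : List Bool) :
    D.pr id z {true} = (D.outputPMF id z true).toReal := by
  rw [RandAlg.pr, PMF.toOuterMeasure_apply_singleton]

/-- The acceptance probability of `D` on `(1ⁿ, g(s))`, `s` uniform on the finite set `S`, is the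
average over `S` of the pointwise acceptance probabilities. [Goldreich 2001, Def. 3.2.2] [folklore] -/
theorem toReal_acceptPMF_map_uniformOfFinset {ι : Type*} (D : RandAlg (List Bool) Bool) (n : ℕ)
    {S : Finset ι} (hS : S.Nonempty) (g : ι → List Bool) :
    (acceptPMF D n ((PMF.uniformOfFinset S hS).map g) true).toReal =
      (∑ s ∈ S, D.pr id (boolPair (unaryEncodeNat n) (g s)) {true}) / S.card := by
  classical
  unfold acceptPMF
  rw [PMF.bind_map, PMF.bind_apply]
  rw [tsum_eq_sum (s := S) (fun b hb => by simp [PMF.uniformOfFinset_apply_of_notMem hS hb])]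
  have hcard : (S.card : ℝ≥0∞) ≠ 0 := by exact_mod_cast hS.card_pos.ne'
  rw [ENNReal.toReal_sum (fun s hs => ENNReal.mul_ne_top
    (by rw [PMF.uniformOfFinset_apply_of_mem hS hs]; exact ENNReal.inv_ne_top.2 hcard)
    (PMF.apply_ne_top _ _))]
  rw [Finset.sum_div]
  refine Finset.sum_congr rfl fun s hs => ?_
  rw [PMF.uniformOfFinset_apply_of_mem hS hs, ENNReal.toReal_mul, ENNReal.toReal_inv,
    ENNReal.toReal_natCast, Function.comp_apply, pr_true_eq_toReal]
  ring

/-- The acceptance probability of `D` on `(1ⁿ, x)`, `x ← U_m`, is the uniform average of the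
pointwise acceptance probabilities. [Goldreich 2001, Def. 3.2.2] [folklore] -/
theorem toReal_acceptPMF_uniformBits (D : RandAlg (List Bool) Bool) (n m : ℕ) :
    (acceptPMF D n (uniformBits m) true).toReal =
      uniformAvg m fun x => D.pr id (boolPair (unaryEncodeNat n) x) {true} := by
  classical
  unfold acceptPMF uniformBits uniformAvg
  rw [PMF.bind_map, PMF.bind_apply, tsum_fintype]
  rw [ENNReal.toReal_sum (fun s _ => ENNReal.mul_ne_top (PMF.apply_ne_top _ _)
    (PMF.apply_ne_top _ _))]
  rw [Finset.sum_div]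
  refine Finset.sum_congr rfl fun v _ => ?_
  simp only [PMF.uniformOfFintype_apply, card_vector, Fintype.card_bool, ENNReal.toReal_mul,
    ENNReal.toReal_inv, Function.comp_apply, pr_true_eq_toReal, Nat.cast_pow, Nat.cast_ofNat,
    ENNReal.toReal_pow, ENNReal.toReal_ofNat]
  ring

/-- Acceptance probability on the conditioned generator output `G(U | S)` as an average over the
(nonempty) conditioning set. [Y. Liu, R. Pass, FOCS 2020, proof of Thm 5.2] [folklore] -/
theorem toReal_acceptPMF_condUniform_map (D : RandAlg (List Bool) Bool) (n : ℕ)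
    {S : Finset (List Bool)} (hS : S.Nonempty) (G : List Bool → List Bool) :
    (acceptPMF D n ((condUniform S).map G) true).toReal =
      (∑ s ∈ S, D.pr id (boolPair (unaryEncodeNat n) (G s)) {true}) / S.card := by
  rw [condUniform_eq hS, toReal_acceptPMF_map_uniformOfFinset]

/-- A `RandAlg` probability as a normalised count of coin strings, `Finset` form (cf.
`RandAlg.pr_eq_card_div`). [Arora–Barak 2009, §7.1] [folklore] -/
theorem _root_.Literature.Computability.Complexity.RandAlg.pr_eq_card_filter_div {α β : Type} (A : RandAlg α β)
    (ea : α → List Bool) (x : α) (P : Set β) [DecidablePred (· ∈ P)] {m : ℕ}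
    (hm : A.coinLen (ea x).length = m) :
    A.pr ea x P = ((Finset.univ.filter fun r : List.Vector Bool m => A.run x r.toList ∈ P).card : ℝ)
      / 2 ^ m := by
  rw [A.pr_eq_card_div ea x P hm]
  congr 2
  simp only [Set.coe_setOf, Nat.card_eq_fintype_card, Fintype.card_subtype]

/-- A finite set of `n`-bit strings has at most `2^n` elements. [folklore] -/
theorem card_le_two_pow_of_length_eq {S : Finset (List Bool)} {n : ℕ}
    (h : ∀ s ∈ S, s.length = n) : S.card ≤ 2 ^ n := by
  classical
  have hsub : S ⊆ (Finset.univ : Finset (List.Vector Bool n)).image List.Vector.toList :=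
    fun s hs => Finset.mem_image.2 ⟨⟨s, h s hs⟩, Finset.mem_univ _, rfl⟩
  calc S.card ≤ ((Finset.univ : Finset (List.Vector Bool n)).image List.Vector.toList).card :=
        Finset.card_le_card hsub
    _ ≤ (Finset.univ : Finset (List.Vector Bool n)).card := Finset.card_image_le
    _ = 2 ^ n := by simp [card_vector]

end CondEPPRG

/-! ### Counting strings of low `K^t`-complexity -/

section KtCount

variable (U : UniversalMachine)

/-- Only finitely many strings have `K^t`-complexity `< m` at a given budget: each is the unique
output of one of the finitely many programs of length `< m`. [Li–Vitányi, Thm 2.2.1;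
Y. Liu, R. Pass, FOCS 2020, §2.2] [cite: LiuPassFOCS2020, §2.2] -/
theorem _root_.Literature.Computability.MetaComplexity.UniversalMachine.finite_setOf_ktAt_lt (t m : ℕ) :
    {x | U.ktAt t x < m}.Finite := by
  refine ((List.finite_length_lt Bool m).biUnion fun prog _ =>
    (show ({x | U.run prog t = some x} : Set (List Bool)).Subsingleton from
      fun x hx y hy => Option.some.inj (hx.symm.trans hy)).finite).subset ?_
  intro x hx
  obtain ⟨prog, hrun, hlen⟩ := U.exists_run_eq_of_ktAt_lt hx
  have hlen' : prog.length < m := by exact_mod_cast hlen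
  exact Set.mem_biUnion (t := fun prog => {x | U.run prog t = some x}) hlen' hrun

/-- Monotonicity of `ℕ`-polynomial evaluation in the argument (private copy; public copies exist
as `Literature.Computability.Complexity.natPoly_eval_mono`, `TM2Iter.eval_mono`, `Literature.Computability.MetaComplexity.polynomial_eval_mono`, none in
this file's import closure — refactor note: hoist one copy into `TimeBounds.lean`). [folklore] -/
private theorem natPoly_eval_mono (p : Polynomial ℕ) {a b : ℕ} (hab : a ≤ b) : p.eval a ≤ p.eval b := by
  rw [Polynomial.eval_eq_sum_range, Polynomial.eval_eq_sum_range]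
  exact Finset.sum_le_sum fun i _ => Nat.mul_le_mul_left _ (Nat.pow_le_pow_left hab i)

variable {U}

/-- **"A random string has high `K^t`-complexity with high probability"** (Liu–Pass, proof of
Thm 5.2, first display): fewer than `2^k` strings of length `m` have `K^t(x) < k`, provided `K^t`
is finite on `{0,1}^m` (so that `liuPassKt` takes no junk value; guaranteed by
`t(m) ≥ (1+ε)m`, `UniversalMachine.kt_lt_top_of_le`). From `UniversalMachine.ncard_setOf_ktAt_lt`.
[Y. Liu, R. Pass, FOCS 2020, proof of Thm 5.2 ("since the total number of Turing machines with
length smaller than `m - γ/4 log n` is only `2^{m - γ/4 log n}`")] [cite: LiuPassFOCS2020, Thm 5.2 (proof)] -/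
theorem card_filter_liuPassKt_lt (t : Polynomial ℕ) {m : ℕ} (k : ℕ)
    (hfin : ∀ x : List Bool, x.length = m → U.ktAt (t.eval m) x < ⊤) :
    ((Finset.univ : Finset (List.Vector Bool m)).filter
      fun v => liuPassKt U t v.toList < k).card < 2 ^ k := by
  classical
  set F := (Finset.univ : Finset (List.Vector Bool m)).filter fun v => liuPassKt U t v.toList < k
  have hfinS := U.finite_setOf_ktAt_lt (t.eval m) k
  have hmap : F.image List.Vector.toList ⊆ hfinS.toFinset := by
    intro x hx
    obtain ⟨v, hv, rfl⟩ := Finset.mem_image.1 hx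
    have hvk := (Finset.mem_filter.1 hv).2
    rw [Set.Finite.mem_toFinset, Set.mem_setOf_eq]
    have hlt := hfin v.toList (by simp)
    rw [liuPassKt_def, v.toList_length] at hvk
    rw [← ENat.coe_toNat hlt.ne]
    exact_mod_cast hvk
  calc F.card = (F.image List.Vector.toList).card :=
        (Finset.card_image_of_injective _ List.Vector.toList_injective).symm
    _ ≤ hfinS.toFinset.card := Finset.card_le_card hmap
    _ = {x | U.ktAt (t.eval m) x < k}.ncard := (Set.ncard_eq_toFinset_card _ hfinS).symm
    _ < 2 ^ k := U.ncard_setOf_ktAt_lt _ _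

end KtCount

/-! ### The distinguisher of Liu–Pass's Thm 5.2 -/

section Distinguisher

/-- The acceptance threshold `m - 3⌊log₂ n⌋` of the distinguisher on `m`-bit samples at
security parameter `n` (print: `m(n) - (3γ/8) log n`; we fix `γ = 8` in the threshold and use the
integer logarithm). [Y. Liu, R. Pass, FOCS 2020, proof of Thm 5.2] [cite: LiuPassFOCS2020, Thm 5.2 (proof)] -/
def lpThr (n m : ℕ) : ℕ := m - 3 * Nat.log 2 n

/-- The deterministic core of Liu–Pass's distinguisher `𝒜` built from a `K^t`-heuristic `ℋ`
(proof of Thm 5.2: "On input `1ⁿ, x` … `𝒜(1ⁿ, x)` lets `w ← ℋ(x)` and outputs `1` if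
`w ≥ m(n) - (3γ/8) log n` and `0` otherwise"): parse the input `⟨1ⁿ, x⟩` (`boolUnpair`), run `ℋ`
on `x` with the given coins, and accept iff the answer is at least `lpThr n |x| = |x| - 3⌊log₂ n⌋`.
[Y. Liu, R. Pass, FOCS 2020, proof of Thm 5.2; arXiv:2009.11514, §5.2] [cite: LiuPassFOCS2020, Thm 5.2 (proof)] -/
def liuPassDistRun (H : RandAlg (List Bool) ℕ) (z r : List Bool) : Bool :=
  decide (lpThr (boolUnpair z).1.length (boolUnpair z).2.length ≤ H.run (boolUnpair z).2 r)

open scoped Classical in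
/-- Recovery of the security parameter from the *length* of the distinguisher's input
`⟨1ⁿ, x⟩`, `|x| = ℓ(n)`: the least `n` with `2n + 2 + ℓ(n) = N` (junk `0` if none). Only used to
give the distinguisher the coin budget of `ℋ` on `ℓ(n)`-bit inputs (coin budgets in
`Literature.Computability.Complexity.RandAlg` are indexed by the encoded input length and need not be computable).
[folklore] -/
noncomputable def lpSeedOf (ℓ : ℕ → ℕ) (N : ℕ) : ℕ :=
  if h : ∃ n, 2 * n + 2 + ℓ n = N then Nat.find h else 0

/-- **Liu–Pass's distinguisher `𝒜 = 𝒜_ℋ`** (proof of Thm 5.2) as a randomized algorithm: run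
`liuPassDistRun ℋ`, with exactly `ℋ`'s coin budget on the sample length `ℓ(n)` (so that `ℋ` is run
on correctly distributed coins), the sample length being read off the input length via
`lpSeedOf ℓ`. [Y. Liu, R. Pass, FOCS 2020, proof of Thm 5.2] [cite: LiuPassFOCS2020, Thm 5.2 (proof)] -/
noncomputable def liuPassDist (H : RandAlg (List Bool) ℕ) (ℓ : ℕ → ℕ) : RandAlg (List Bool) Bool where
  run := liuPassDistRun H
  coinLen N := H.coinLen (min N (ℓ (lpSeedOf ℓ N)))

/-- The distinguisher on a well-formed input `⟨a, x⟩`. [cite: LiuPassFOCS2020, Thm 5.2 (proof)] -/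
@[simp] theorem liuPassDistRun_boolPair (H : RandAlg (List Bool) ℕ) (a x r : List Bool) :
    liuPassDistRun H (boolPair a x) r = decide (lpThr a.length x.length ≤ H.run x r) := by
  simp [liuPassDistRun, boolUnpair_boolPair]

/-- If the input length `2n + 2 + ℓ(n)` of `⟨1ⁿ, x⟩` (`|x| = ℓ(n)`) is not attained by any smaller
security parameter, `lpSeedOf` recovers `n`. [folklore] -/
theorem lpSeedOf_eq {ℓ : ℕ → ℕ} {n : ℕ} (h : ∀ n' < n, 2 * n' + ℓ n' < 2 * n + ℓ n) :
    lpSeedOf ℓ (2 * n + 2 + ℓ n) = n := by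
  classical
  have hex : ∃ n', 2 * n' + 2 + ℓ n' = 2 * n + 2 + ℓ n := ⟨n, rfl⟩
  rw [lpSeedOf, dif_pos hex, Nat.find_eq_iff]
  refine ⟨rfl, fun n' hn' heq => ?_⟩
  have := h n' hn'
  omega

/-- Under the same no-collision condition the distinguisher's coin budget on `⟨1ⁿ, x⟩`,
`|x| = ℓ(n)`, is `ℋ`'s budget on `ℓ(n)`-bit inputs. [folklore] -/
theorem liuPassDist_coinLen (H : RandAlg (List Bool) ℕ) {ℓ : ℕ → ℕ} {n : ℕ}
    (h : ∀ n' < n, 2 * n' + ℓ n' < 2 * n + ℓ n) :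
    (liuPassDist H ℓ).coinLen (2 * n + 2 + ℓ n) = H.coinLen (ℓ n) := by
  simp only [liuPassDist, lpSeedOf_eq h]
  congr 1
  omega

/-- **Efficiency of Liu–Pass's distinguisher** (proof of Thm 5.2: "we now construct a PPT
distinguisher `𝒜`"). For every PPT heuristic `ℋ` (natural-number output in binary), the map
`(⟨1ⁿ, x⟩, r) ↦ [ℋ(x; r) ≥ |x| - 3⌊log₂ n⌋]` — one `boolUnpair`, one call to `ℋ` with the coins
passed through unchanged, an integer logarithm and a comparison — is polynomial-time computable in the tree's TM2 sense.
Named efficiency fact (D-0014). Closure of `PolyTimeComputable` under composition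
(`Literature.Computability.Complexity.PolyTimeComputable.comp_holds`) and `polyTimeComputable_boolUnpair` are in the
tree, but a discharge additionally needs TM2 routines that are not: (i) re-pairing
`⟨⟨1ⁿ, x⟩, r⟩ ↦ ⟨x, r⟩` for the call to `ℋ` *while retaining* `n` and `|x|` for the final test
(a "run on the second component, keep the first" combinator plus string duplication), and (ii) the
arithmetic of the threshold, `lpThr n |x| = |x| - 3⌊log₂ n⌋` (length, integer logarithm,
subtraction) and the comparison with `ℋ`'s binary output. `IsPolyTime` is Gill-style (polynomial
time on *all* coin strings), so `ℋ.run` composes as an ordinary polynomial-time map.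
[Y. Liu, R. Pass, FOCS 2020, proof of Thm 5.2; S. Arora, B. Barak, *Computational Complexity*,
CUP 2009, Thm 1.9 and §7.1] [cite: LiuPassFOCS2020, Thm 5.2 (proof)] -/
def liuPassDistRun_polyTime : Prop :=
  ∀ H : RandAlg (List Bool) ℕ, IsPPT H encodeNat →
    PolyTimeComputable (fun p : List Bool × List Bool => boolPair p.1 p.2) encodeBool
      (Function.uncurry (liuPassDistRun H))

/-- Granted the efficiency fact, the distinguisher is PPT: its coin budget is `ℋ`'s at a length
`≤ N`, hence polynomially bounded (`ℕ`-polynomials are monotone). [Y. Liu, R. Pass, FOCS 2020,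
proof of Thm 5.2] [cite: LiuPassFOCS2020, Thm 5.2 (proof)] -/
theorem isPPT_liuPassDist (hD : liuPassDistRun_polyTime) {H : RandAlg (List Bool) ℕ}
    (hH : IsPPT H encodeNat) (ℓ : ℕ → ℕ) : IsPPT (liuPassDist H ℓ) encodeBool := by
  obtain ⟨p, hp⟩ := hH.2
  refine ⟨hD H hH, p, fun N => ?_⟩
  exact (hp _).trans (natPoly_eval_mono p (min_le_left _ _))

end Distinguisher

/-! ### Claim 1: the distinguisher accepts random strings -/

section Claims

variable {U : UniversalMachine} {t : Polynomial ℕ}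

/-- **Claim 1 of the proof of Thm 5.2** (linear form): on `x ← U_m` the distinguisher `𝒜_ℋ`
accepts with probability at least `Pr[ℋ(x) = f(x)] - Pr[f(x) < m - 3⌊log₂ n⌋]`, since it accepts
whenever `ℋ` is right and `f(x)` is above the threshold (`f = K^t`; print continues with the
counting bound `Pr[K^t(x) < ·]`, `card_filter_liuPassKt_lt`). The coin budget of `𝒜` on
`⟨1ⁿ, x⟩` must be `ℋ`'s on `m`-bit inputs (`hcoin`). [Y. Liu, R. Pass, FOCS 2020, proof of
Thm 5.2, Claim 1] [cite: LiuPassFOCS2020, Thm 5.2 (proof, Claim 1)] -/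
theorem avgSuccessProb_sub_le_uniformAvg (H : RandAlg (List Bool) ℕ) (ℓ : ℕ → ℕ) {n m : ℕ}
    (hcoin : (liuPassDist H ℓ).coinLen (2 * n + 2 + m) = H.coinLen m) (f : List Bool → ℕ) :
    avgSuccessProb f H m -
        ((Finset.univ.filter fun v : List.Vector Bool m => f v.toList < lpThr n m).card : ℝ) / 2 ^ m
      ≤ uniformAvg m fun x => (liuPassDist H ℓ).pr id (boolPair (unaryEncodeNat n) x) {true} := by
  classical
  set D := liuPassDist H ℓ with hD
  set K := H.coinLen m with hKdef
  unfold avgSuccessProb uniformAvg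
  rw [← sub_div, div_le_div_iff_of_pos_right (by positivity), Finset.natCast_card_filter,
    ← Finset.sum_sub_distrib]
  refine Finset.sum_le_sum fun v _ => ?_
  dsimp only
  have hHK : H.coinLen (id v.toList).length = K := by simp [hKdef]
  have hDK : D.coinLen (id (boolPair (unaryEncodeNat n) v.toList)).length = K := by
    simp only [id, length_boolPair, length_unaryEncodeNat, List.Vector.toList_length]
    exact hcoin
  by_cases hlow : f v.toList < lpThr n m
  · rw [if_pos hlow]
    linarith [H.pr_le_one id v.toList {f v.toList}, D.pr_nonneg id (boolPair (unaryEncodeNat n) v.toList) {true}]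
  · rw [if_neg hlow, sub_zero, H.pr_eq_card_filter_div id _ _ hHK, D.pr_eq_card_filter_div id _ _ hDK,
      div_le_div_iff_of_pos_right (by positivity)]
    exact_mod_cast Finset.card_le_card fun r hr => by
      simp only [Finset.mem_filter, Finset.mem_univ, true_and, Set.mem_singleton_iff] at hr ⊢
      simp only [hD, liuPassDist, liuPassDistRun_boolPair, length_unaryEncodeNat,
        List.Vector.toList_length, hr, decide_eq_true_eq]
      exact not_lt.1 hlow

/-- `2^m · Pr_{x ← U_m}[ℋ(x) ≠ f(x)]` as a sum of pointwise failure probabilities. [folklore] -/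
theorem two_pow_mul_one_sub_avgSuccessProb {β : Type} (f : List Bool → β) (A : RandAlg (List Bool) β)
    (m : ℕ) : (2 : ℝ) ^ m * (1 - avgSuccessProb f A m) =
      ∑ v : List.Vector Bool m, (1 - A.pr id v.toList {f v.toList}) := by
  unfold avgSuccessProb uniformAvg
  rw [Finset.sum_sub_distrib, Finset.sum_const, Finset.card_univ, card_vector, Fintype.card_bool,
    nsmul_eq_mul, mul_one, mul_sub, mul_one, mul_div_cancel₀ _ (by positivity)]
  push_cast
  ring

/-- **Claim 2 of the proof of Thm 5.2** (linear form, no "good coins" step). Let `S` be the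
(nonempty) conditioning event, `G` the generator with `m`-bit outputs on `S`, all of which have
`f`-value below the threshold (`f = K^t`: "any string output by the EP-PRG must have low `K^t`
complexity"), and suppose the surprises of `G(U_S)` are `≤ n` with average (entropy)
`≥ n - a`. Then `Pr[𝒜_ℋ(1ⁿ, G(U_S)) = 1] ≤ a/(a+1) + 2^{a+1-n} · 2^m · Pr_{x ← U_m}[ℋ(x) ≠ f(x)]`:
for each coin string `r`, acceptance of `y = G(s)` forces `ℋ_r(y) ≥` threshold `> f(y)`, i.e. a
failure of `ℋ_r` at `y`, so by the counting core (`card_filter_div_card_le_of_mapEntropy`)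
`Pr_s[𝒜_r accepts G(s)] ≤ a/(a+1) + 2^{a+1-n} #{y ∈ {0,1}^m : ℋ_r(y) ≠ f(y)}`, and averaging over
`r` turns the count into `2^m · Pr[ℋ fails]`. (Print fixes a good `r` by Markov first; taking the
expectation over `r` directly gives the same bound linearly.) [Y. Liu, R. Pass, FOCS 2020, proof
of Thm 5.2, Claim 2; arXiv:2009.11514, §5.2] [cite: LiuPassFOCS2020, Thm 5.2 (proof, Claim 2)] -/
theorem sum_pr_liuPassDist_div_card_le (H : RandAlg (List Bool) ℕ) (ℓ : ℕ → ℕ) {n m : ℕ}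
    {S : Finset (List Bool)} (hS : S.Nonempty) (G : List Bool → List Bool)
    (hlen : ∀ s ∈ S, (G s).length = m)
    (hcoin : (liuPassDist H ℓ).coinLen (2 * n + 2 + m) = H.coinLen m)
    (f : List Bool → ℕ) (hlow : ∀ s ∈ S, f (G s) < lpThr n m) {a : ℝ} (ha : 0 ≤ a)
    (hX : ∀ v ∈ S, Real.logb 2 ((S.card : ℝ) / (fiber S G (G v)).card) ≤ n)
    (hH : (n : ℝ) - a ≤ mapEntropy S G) :
    (∑ s ∈ S, (liuPassDist H ℓ).pr id (boolPair (unaryEncodeNat n) (G s)) {true}) / S.card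
      ≤ a / (a + 1) + (2 : ℝ) ^ (a + 1 - n) * (2 ^ m * (1 - avgSuccessProb f H m)) := by
  classical
  set D := liuPassDist H ℓ with hD
  set K := H.coinLen m with hKdef
  have hSpos : (0 : ℝ) < S.card := by exact_mod_cast hS.card_pos
  have h2K : (0 : ℝ) < 2 ^ K := by positivity
  -- Step 1: acceptance probabilities as coin counts, `Q r y :↔ ℋ_r(y) ≥ threshold`
  have hpr : ∀ s ∈ S, D.pr id (boolPair (unaryEncodeNat n) (G s)) {true} =
      (∑ r : List.Vector Bool K, if lpThr n m ≤ H.run (G s) r.toList then (1 : ℝ) else 0) / 2 ^ K := by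
    intro s hs
    have hDK : D.coinLen (id (boolPair (unaryEncodeNat n) (G s))).length = K := by
      simp only [id, length_boolPair, length_unaryEncodeNat, hlen s hs]
      exact hcoin
    rw [D.pr_eq_card_filter_div id _ {true} hDK, Finset.natCast_card_filter]
    congr 1
    refine Finset.sum_congr rfl fun r _ => ?_
    simp only [hD, liuPassDist, liuPassDistRun_boolPair, length_unaryEncodeNat, hlen s hs,
      Set.mem_singleton_iff, decide_eq_true_eq]
  have hlhs : (∑ s ∈ S, D.pr id (boolPair (unaryEncodeNat n) (G s)) {true}) / S.card =
      (∑ r : List.Vector Bool K, ((S.filter fun s => lpThr n m ≤ H.run (G s) r.toList).card : ℝ)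
        / S.card) / 2 ^ K := by
    rw [Finset.sum_congr rfl hpr, ← Finset.sum_div, Finset.sum_comm, ← Finset.sum_div, div_right_comm]
    congr 1
    congr 1
    refine Finset.sum_congr rfl fun r _ => ?_
    rw [Finset.natCast_card_filter]
  -- Step 2: the counting core, coin string by coin string
  have hcore : ∀ r : List.Vector Bool K,
      ((S.filter fun s => lpThr n m ≤ H.run (G s) r.toList).card : ℝ) / S.card ≤
        a / (a + 1) + (2 : ℝ) ^ (a + 1 - n) *
          ((Finset.univ.filter fun v : List.Vector Bool m => H.run v.toList r.toList ≠ f v.toList).card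
            : ℝ) := by
    intro r
    refine (card_filter_div_card_le_of_mapEntropy hS G ha hX hH
      (fun y => lpThr n m ≤ H.run y r.toList)).trans ?_
    gcongr
    -- accepted outputs are failures of `ℋ_r` among the `m`-bit strings
    have hsub : (S.image G).filter (fun y => lpThr n m ≤ H.run y r.toList) ⊆
        (Finset.univ.filter fun v : List.Vector Bool m =>
          H.run v.toList r.toList ≠ f v.toList).image List.Vector.toList := by
      intro y hy
      simp only [Finset.mem_filter, Finset.mem_image] at hy ⊢
      obtain ⟨⟨s, hs, rfl⟩, hthr⟩ := hy
      refine ⟨⟨G s, hlen s hs⟩, ⟨Finset.mem_univ _, ?_⟩, rfl⟩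
      simp only [List.Vector.toList_mk]
      have := hlow s hs
      omega
    calc ((S.image G).filter fun y => lpThr n m ≤ H.run y r.toList).card
        ≤ ((Finset.univ.filter fun v : List.Vector Bool m =>
            H.run v.toList r.toList ≠ f v.toList).image List.Vector.toList).card :=
          Finset.card_le_card hsub
      _ ≤ _ := Finset.card_image_le
  -- Step 3: averaging the failure counts over the coins gives `2^m · Pr[ℋ fails]`
  have hfail : (∑ r : List.Vector Bool K,
      ((Finset.univ.filter fun v : List.Vector Bool m => H.run v.toList r.toList ≠ f v.toList).card
        : ℝ)) / 2 ^ K = 2 ^ m * (1 - avgSuccessProb f H m) := by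
    rw [two_pow_mul_one_sub_avgSuccessProb]
    simp_rw [Finset.natCast_card_filter]
    rw [Finset.sum_comm, Finset.sum_div]
    refine Finset.sum_congr rfl fun v _ => ?_
    have hHK : H.coinLen (id v.toList).length = K := by simp [hKdef]
    rw [H.pr_eq_card_filter_div id _ _ hHK, Finset.natCast_card_filter, eq_sub_iff_add_eq,
      ← add_div, ← Finset.sum_add_distrib]
    rw [div_eq_one_iff_eq h2K.ne']
    have : ∀ r : List.Vector Bool K, ((if H.run v.toList r.toList ≠ f v.toList then (1 : ℝ) else 0) +
        if H.run v.toList r.toList ∈ ({f v.toList} : Set ℕ) then (1 : ℝ) else 0) = 1 := by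
      intro r
      by_cases h : H.run v.toList r.toList = f v.toList <;> simp [h]
    rw [Finset.sum_congr rfl fun r _ => this r, Finset.sum_const, Finset.card_univ, card_vector,
      Fintype.card_bool, nsmul_eq_mul, mul_one]
    push_cast
    ring
  -- assemble
  rw [hlhs, div_le_iff₀ h2K]
  calc ∑ r : List.Vector Bool K, ((S.filter fun s => lpThr n m ≤ H.run (G s) r.toList).card : ℝ) / S.card
      ≤ ∑ r : List.Vector Bool K, (a / (a + 1) + (2 : ℝ) ^ (a + 1 - n) *
          ((Finset.univ.filter fun v : List.Vector Bool m =>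
            H.run v.toList r.toList ≠ f v.toList).card : ℝ)) := Finset.sum_le_sum fun r _ => hcore r
    _ = 2 ^ K * (a / (a + 1)) + (2 : ℝ) ^ (a + 1 - n) * ∑ r : List.Vector Bool K,
          ((Finset.univ.filter fun v : List.Vector Bool m =>
            H.run v.toList r.toList ≠ f v.toList).card : ℝ) := by
        rw [Finset.sum_add_distrib, Finset.sum_const, Finset.card_univ, card_vector,
          Fintype.card_bool, nsmul_eq_mul, Finset.mul_sum]
        push_cast
        rfl
    _ = (a / (a + 1) + (2 : ℝ) ^ (a + 1 - n) * (2 ^ m * (1 - avgSuccessProb f H m))) * 2 ^ K := by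
        rw [← hfail]
        field_simp

end Claims

/-! ### Elementary estimates for the assembly -/

section Estimates

/-- `2^{α log₂ n} = n^α`. [folklore] -/
theorem two_rpow_natCast_mul_logb (α : ℕ) {n : ℕ} (hn : 0 < n) :
    (2 : ℝ) ^ ((α : ℝ) * Real.logb 2 n) = (n : ℝ) ^ α := by
  rw [mul_comm, Real.rpow_mul (by norm_num), Real.rpow_logb (by norm_num) (by norm_num)
    (by exact_mod_cast hn), Real.rpow_natCast]

/-- `log₂ n ≤ n`. [folklore] -/
theorem logb_two_natCast_le {n : ℕ} (hn : 0 < n) : Real.logb 2 n ≤ n := by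
  rw [Real.logb_le_iff_le_rpow (by norm_num) (by exact_mod_cast hn), Real.rpow_natCast]
  exact_mod_cast n.lt_two_pow_self.le

/-- `3⌊log₂ n⌋ ≤ n` for `n ≥ 16`. [folklore] -/
theorem three_mul_log_le {n : ℕ} (hn : 16 ≤ n) : 3 * Nat.log 2 n ≤ n := by
  have h4 : 4 ≤ Nat.log 2 n := Nat.le_log_of_pow_le (by norm_num) (by norm_num; omega)
  have h1 : 2 ^ Nat.log 2 n ≤ n := Nat.pow_log_le_self 2 (by omega)
  have h2 := two_mul_le_two_pow_pred h4
  have h3 : 2 ^ (Nat.log 2 n - 1) * 2 = 2 ^ Nat.log 2 n := by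
    rw [← pow_succ]
    congr 1
    omega
  omega

end Estimates

/-! ### One security parameter: the distinguisher's advantage is at least `1/n²` -/

section OneLength

variable {U : UniversalMachine} {t : Polynomial ℕ}

/-- **Claim 1 with the counting bound, at one security parameter** (the uniform side of the
proof of Thm 5.2): for `n ≥ 16`, `m = ℓ(n) ≥ n` and `K^t` finite on `{0,1}^m`,
`Pr[𝒜_ℋ(1ⁿ, U_m) = 1] ≥ Pr_{x ← U_m}[ℋ(x) = K^t(x)] - 8/n³`, since fewer than `2^{m - 3⌊log₂ n⌋}`
strings lie below the threshold and `2^{-3⌊log₂ n⌋} ≤ 8/n³`. [Y. Liu, R. Pass, FOCS 2020, proof of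
Thm 5.2, Claim 1 with eq. (1); arXiv:2009.11514, §5.2] [cite: LiuPassFOCS2020, Thm 5.2 (proof, Claim 1)] -/
theorem avgSuccessProb_sub_le_pr_uniform (H : RandAlg (List Bool) ℕ) (ℓ : ℕ → ℕ) {n n₀ : ℕ}
    (hn16 : 16 ≤ n) (hℓlo : n ≤ ℓ n) (hn₀ : n₀ ≤ n)
    (hcoin : (liuPassDist H ℓ).coinLen (2 * n + 2 + ℓ n) = H.coinLen (ℓ n))
    (hfin : ∀ x : List Bool, n₀ ≤ x.length → U.ktAt (t.eval x.length) x < ⊤) :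
    avgSuccessProb (liuPassKt U t) H (ℓ n) - 8 / (n : ℝ) ^ 3 ≤
      (acceptPMF (liuPassDist H ℓ) n (uniformBits (ℓ n)) true).toReal := by
  classical
  set L := Nat.log 2 n with hL
  have hn0 : 0 < n := by omega
  have h3L : 3 * L ≤ n := three_mul_log_le hn16
  have h2L : 2 ^ L ≤ n := Nat.pow_log_le_self 2 hn0.ne'
  have hnL : n < 2 ^ L * 2 := by
    have := Nat.lt_pow_succ_log_self one_lt_two n
    rwa [pow_succ] at this
  set m := ℓ n with hm
  have hnR : (0 : ℝ) < n := by exact_mod_cast hn0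
  have hn3 : (0 : ℝ) < (n : ℝ) ^ 3 := by positivity
  have hfinm : ∀ x : List Bool, x.length = m → U.ktAt (t.eval m) x < ⊤ := fun x hx => by
    have := hfin x (by omega)
    rwa [hx] at this
  have hcount := card_filter_liuPassKt_lt (U := U) t (lpThr n m) hfinm
  have hU := avgSuccessProb_sub_le_uniformAvg H ℓ (n := n) (m := m) hcoin (liuPassKt U t)
  have hlowfrac : (((Finset.univ.filter fun v : List.Vector Bool m =>
      liuPassKt U t v.toList < lpThr n m).card : ℕ) : ℝ) / 2 ^ m ≤ 8 / (n : ℝ) ^ 3 := by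
    have h1 : (((Finset.univ.filter fun v : List.Vector Bool m =>
        liuPassKt U t v.toList < lpThr n m).card : ℕ) : ℝ) ≤ 2 ^ (m - 3 * L) := by
      exact_mod_cast hcount.le
    have h2 : (2 : ℝ) ^ m = 2 ^ (m - 3 * L) * (2 ^ L) ^ 3 := by
      rw [← pow_mul, ← pow_add]
      congr 1
      omega
    have h4 : (n : ℝ) ≤ 2 * 2 ^ L := by exact_mod_cast (by omega : n ≤ 2 * 2 ^ L)
    calc (((Finset.univ.filter fun v : List.Vector Bool m =>
          liuPassKt U t v.toList < lpThr n m).card : ℕ) : ℝ) / 2 ^ m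
        ≤ 2 ^ (m - 3 * L) / 2 ^ m := by gcongr
      _ = 8 / (2 * (2 : ℝ) ^ L) ^ 3 := by
          rw [h2]
          field_simp
          norm_num
      _ ≤ 8 / (n : ℝ) ^ 3 :=
          div_le_div_of_nonneg_left (by norm_num) hn3 (pow_le_pow_left₀ hnR.le h4 3)
  rw [toReal_acceptPMF_uniformBits]
  linarith [hU, hlowfrac]

/-- **Claim 2 with the parameter estimates, at one security parameter** (the generator side of
the proof of Thm 5.2): for `m = ℓ(n)` with `n ≤ m ≤ n + γ⌊log₂ n⌋`, a nonempty event
`S ⊆ {0,1}^n`, entropy `H(G(U_S)) ≥ n - α log₂ n` and `K^t(G(s)) + 3⌊log₂ n⌋ < m` on `S`,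
`Pr[𝒜_ℋ(1ⁿ, G(U_S)) = 1] ≤ a/(a+1) + 2 n^{α+γ} · Pr_{x ← U_m}[ℋ(x) ≠ K^t(x)]` with `a = α log₂ n`
(from `sum_pr_liuPassDist_div_card_le` and `2^{a+1-n} · 2^m ≤ 2 n^{α+γ}`). [Y. Liu, R. Pass,
FOCS 2020, proof of Thm 5.2, Claim 2; arXiv:2009.11514, §5.2] [cite: LiuPassFOCS2020, Thm 5.2 (proof, Claim 2)] -/
theorem pr_condUniform_map_le (H : RandAlg (List Bool) ℕ) (ℓ : ℕ → ℕ) {γ α n : ℕ} (hn0 : 0 < n)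
    (hℓlo : n ≤ ℓ n) (hℓhi : ℓ n ≤ n + γ * Nat.log 2 n)
    {S : Finset (List Bool)} (hS : S.Nonempty) (hSlen : ∀ s ∈ S, s.length = n)
    (G : List Bool → List Bool) (hlen : ∀ s : List Bool, s.length = n → (G s).length = ℓ n)
    (hent : (n : ℝ) - α * Real.logb 2 n ≤ mapEntropy S G)
    (hcoin : (liuPassDist H ℓ).coinLen (2 * n + 2 + ℓ n) = H.coinLen (ℓ n))
    (hKG : ∀ s ∈ S, liuPassKt U t (G s) + 3 * Nat.log 2 n < ℓ n) :
    (acceptPMF (liuPassDist H ℓ) n ((condUniform S).map G) true).toReal ≤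
      α * Real.logb 2 n / (α * Real.logb 2 n + 1) +
        2 * (n : ℝ) ^ (α + γ) * (1 - avgSuccessProb (liuPassKt U t) H (ℓ n)) := by
  classical
  set L := Nat.log 2 n with hL
  have h2L : 2 ^ L ≤ n := Nat.pow_log_le_self 2 hn0.ne'
  set m := ℓ n with hm
  set D := liuPassDist H ℓ with hD
  have hnR : (0 : ℝ) < n := by exact_mod_cast hn0
  have h1n : (1 : ℝ) ≤ n := by exact_mod_cast hn0
  have hlow : ∀ s ∈ S, liuPassKt U t (G s) < lpThr n m := by
    intro s hs
    have h1 := hKG s hs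
    show liuPassKt U t (G s) < m - 3 * L
    omega
  have hSle : S.card ≤ 2 ^ n := card_le_two_pow_of_length_eq hSlen
  have hX : ∀ v ∈ S, Real.logb 2 ((S.card : ℝ) / (fiber S G (G v)).card) ≤ n := fun v hv =>
    logb_card_div_card_fiber_le_of_card_le G hv hSle
  set a : ℝ := α * Real.logb 2 n with ha
  have hlogb0 : 0 ≤ Real.logb 2 n := Real.logb_nonneg one_lt_two h1n
  have ha0 : 0 ≤ a := mul_nonneg (Nat.cast_nonneg _) hlogb0
  have hC := sum_pr_liuPassDist_div_card_le H ℓ (n := n) (m := m) hS G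
    (fun s hs => hlen s (hSlen s hs)) hcoin (liuPassKt U t) hlow ha0 hX hent
  have hpowbound : (2 : ℝ) ^ (a + 1 - n) * 2 ^ m ≤ 2 * (n : ℝ) ^ (α + γ) := by
    have e1 : (2 : ℝ) ^ (a + 1 - n) = 2 ^ a * 2 / 2 ^ n := by
      rw [Real.rpow_sub two_pos, Real.rpow_add two_pos, Real.rpow_one, Real.rpow_natCast]
    have e2 : (2 : ℝ) ^ a = (n : ℝ) ^ α := two_rpow_natCast_mul_logb α hn0
    have e3 : (2 : ℝ) ^ m = 2 ^ n * 2 ^ (m - n) := by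
      rw [← pow_add]
      congr 1
      omega
    have e4 : (2 : ℝ) ^ (m - n) ≤ (n : ℝ) ^ γ := by
      have hle : m - n ≤ γ * L := by omega
      calc (2 : ℝ) ^ (m - n) ≤ 2 ^ (γ * L) := pow_le_pow_right₀ one_le_two hle
        _ = (2 ^ L) ^ γ := by rw [mul_comm, pow_mul]
        _ ≤ (n : ℝ) ^ γ := by
            gcongr
            exact_mod_cast h2L
    rw [e1, e2, e3]
    have h2n : (0 : ℝ) < 2 ^ n := by positivity
    calc (n : ℝ) ^ α * 2 / 2 ^ n * (2 ^ n * 2 ^ (m - n)) = 2 * (n : ℝ) ^ α * 2 ^ (m - n) := by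
          field_simp
      _ ≤ 2 * (n : ℝ) ^ α * (n : ℝ) ^ γ := by gcongr
      _ = 2 * (n : ℝ) ^ (α + γ) := by rw [pow_add]; ring
  have h1mavg : 0 ≤ 1 - avgSuccessProb (liuPassKt U t) H m :=
    sub_nonneg.2 (avgSuccessProb_le_one _ _ _)
  rw [toReal_acceptPMF_condUniform_map D n hS G]
  calc (∑ s ∈ S, D.pr id (boolPair (unaryEncodeNat n) (G s)) {true}) / S.card
      ≤ a / (a + 1) + (2 : ℝ) ^ (a + 1 - n) * (2 ^ m * (1 - avgSuccessProb (liuPassKt U t) H m)) := hC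
    _ = a / (a + 1) + ((2 : ℝ) ^ (a + 1 - n) * 2 ^ m) * (1 - avgSuccessProb (liuPassKt U t) H m) := by
        ring
    _ ≤ a / (a + 1) + (2 * (n : ℝ) ^ (α + γ)) * (1 - avgSuccessProb (liuPassKt U t) H m) := by
        gcongr

/-- **The conclusion of the proof of Thm 5.2 at one (large) security parameter.** Fix `n` and an
output length `m = ℓ(n)` with `n ≤ m ≤ n + γ⌊log₂ n⌋`, a nonempty conditioning event
`S ⊆ {0,1}^n` and a generator `G` with `m`-bit outputs on `n`-bit seeds, entropy
`H(G(U_S)) ≥ n - α log₂ n`, and `K^t(G(s)) + 3⌊log₂ n⌋ < m` on `S` (print: "`K^t(G(s)) = n + O(1)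
≤ m - γ/2 log n`", eq. (2)); let `K^t` be finite on `{0,1}^m` and let the heuristic `ℋ` beat
`1 - 1/p(m)`, `p(m) = m^{α+γ+3} + 1`, on `U_m`. If `n` is large (`n ≥ 16`, `n ≥ 12(α+1)`) then
Liu–Pass's distinguisher `𝒜_ℋ` tells `G(U_S)` from `U_m` with advantage `≥ 1/n²`: by Claim 1 and
the counting bound it accepts `U_m` with probability `> 1 - 1/p(m) - 8/n³`, by Claim 2 it accepts
`G(U_S)` with probability `< α log₂ n / (α log₂ n + 1) + 2/n³`, and
`1/(α log₂ n + 1) - 11/n³ ≥ 1/n²`. (Print: advantage `≥ 1/n - 4/n² ≥ 1/n²` with `γ ≥ 8`.)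
[Y. Liu, R. Pass, FOCS 2020, proof of Thm 5.2 (conclusion); arXiv:2009.11514, §5.2]
[cite: LiuPassFOCS2020, Thm 5.2 (proof)] -/
theorem inv_sq_le_advantage (H : RandAlg (List Bool) ℕ) {γ α n₀ : ℕ}
    (ℓ : ℕ → ℕ) {n : ℕ} (hℓlo : n ≤ ℓ n) (hℓhi : ℓ n ≤ n + γ * Nat.log 2 n)
    (hn16 : 16 ≤ n) (hnα : 12 * (α + 1) ≤ n) (hn₀ : n₀ ≤ n)
    {S : Finset (List Bool)} (hS : S.Nonempty) (hSlen : ∀ s ∈ S, s.length = n)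
    (G : List Bool → List Bool) (hlen : ∀ s : List Bool, s.length = n → (G s).length = ℓ n)
    (hent : (n : ℝ) - α * Real.logb 2 n ≤ mapEntropy S G)
    (hcoin : (liuPassDist H ℓ).coinLen (2 * n + 2 + ℓ n) = H.coinLen (ℓ n))
    (hKG : ∀ s ∈ S, liuPassKt U t (G s) + 3 * Nat.log 2 n < ℓ n)
    (hfin : ∀ x : List Bool, n₀ ≤ x.length → U.ktAt (t.eval x.length) x < ⊤)
    (hgood : 1 - 1 / (((ℓ n) ^ (α + γ + 3) + 1 : ℕ) : ℝ) < avgSuccessProb (liuPassKt U t) H (ℓ n)) :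
    1 / (n : ℝ) ^ 2 ≤ |(acceptPMF (liuPassDist H ℓ) n ((condUniform S).map G) true).toReal -
        (acceptPMF (liuPassDist H ℓ) n (uniformBits (ℓ n)) true).toReal| := by
  classical
  -- integer bookkeeping
  set L := Nat.log 2 n with hL
  set k := α + γ + 3 with hk
  have hn0 : 0 < n := by omega
  have hmn : n ≤ ℓ n := hℓlo
  have h3L : 3 * L ≤ n := three_mul_log_le hn16
  have h2L : 2 ^ L ≤ n := Nat.pow_log_le_self 2 hn0.ne'
  have hnL : n < 2 ^ L * 2 := by
    have := Nat.lt_pow_succ_log_self one_lt_two n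
    rwa [pow_succ] at this
  set m := ℓ n with hm
  set D := liuPassDist H ℓ with hD
  have hnR : (0 : ℝ) < n := by exact_mod_cast hn0
  have h1n : (1 : ℝ) ≤ n := by exact_mod_cast hn0
  have hmR : (n : ℝ) ≤ m := by exact_mod_cast hmn
  -- the hardness polynomial at `m`
  set P : ℝ := ((m ^ k + 1 : ℕ) : ℝ) with hP
  have hnk : (n : ℝ) ^ 3 ≤ (n : ℝ) ^ k := pow_le_pow_right₀ h1n (by omega)
  have hPgt : (n : ℝ) ^ k < P := by
    rw [hP]
    push_cast
    calc (n : ℝ) ^ k ≤ (m : ℝ) ^ k := pow_le_pow_left₀ hnR.le hmR k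
      _ < (m : ℝ) ^ k + 1 := lt_add_one _
  have hn3 : (0 : ℝ) < (n : ℝ) ^ 3 := by positivity
  have hPpos : 0 < P := hn3.trans_le (hnk.trans hPgt.le)
  have hP3 : 1 / P ≤ 1 / (n : ℝ) ^ 3 := one_div_le_one_div_of_le hn3 (hnk.trans hPgt.le)
  -- ### the uniform side (Claim 1 + counting)
  have hfinm : ∀ x : List Bool, x.length = m → U.ktAt (t.eval m) x < ⊤ := fun x hx => by
    have := hfin x (by omega)
    rwa [hx] at this
  have hcount := card_filter_liuPassKt_lt (U := U) t (lpThr n m) hfinm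
  have hU := avgSuccessProb_sub_le_uniformAvg H ℓ (n := n) (m := m) hcoin (liuPassKt U t)
  have hlowfrac : (((Finset.univ.filter fun v : List.Vector Bool m =>
      liuPassKt U t v.toList < lpThr n m).card : ℕ) : ℝ) / 2 ^ m ≤ 8 / (n : ℝ) ^ 3 := by
    have h1 : (((Finset.univ.filter fun v : List.Vector Bool m =>
        liuPassKt U t v.toList < lpThr n m).card : ℕ) : ℝ) ≤ 2 ^ (m - 3 * L) := by
      exact_mod_cast hcount.le
    have h2 : (2 : ℝ) ^ m = 2 ^ (m - 3 * L) * (2 ^ L) ^ 3 := by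
      rw [← pow_mul, ← pow_add]
      congr 1
      omega
    have h4 : (n : ℝ) ≤ 2 * 2 ^ L := by exact_mod_cast (by omega : n ≤ 2 * 2 ^ L)
    have h2Lpos : (0 : ℝ) < 2 ^ L := by positivity
    calc (((Finset.univ.filter fun v : List.Vector Bool m =>
          liuPassKt U t v.toList < lpThr n m).card : ℕ) : ℝ) / 2 ^ m
        ≤ 2 ^ (m - 3 * L) / 2 ^ m := by gcongr
      _ = 8 / (2 * (2 : ℝ) ^ L) ^ 3 := by
          rw [h2]
          field_simp
          norm_num
      _ ≤ 8 / (n : ℝ) ^ 3 :=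
          div_le_div_of_nonneg_left (by norm_num) hn3 (pow_le_pow_left₀ hnR.le h4 3)
  have hPrU : 1 - 1 / P - 8 / (n : ℝ) ^ 3 < (acceptPMF D n (uniformBits m) true).toReal := by
    rw [toReal_acceptPMF_uniformBits]
    rw [← hD] at hU
    linarith [hU, hgood, hlowfrac]
  -- ### the generator side (Claim 2)
  have hlow : ∀ s ∈ S, liuPassKt U t (G s) < lpThr n m := by
    intro s hs
    have h1 := hKG s hs
    show liuPassKt U t (G s) < m - 3 * L
    omega
  have hSle : S.card ≤ 2 ^ n := card_le_two_pow_of_length_eq hSlen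
  have hX : ∀ v ∈ S, Real.logb 2 ((S.card : ℝ) / (fiber S G (G v)).card) ≤ n := fun v hv =>
    logb_card_div_card_fiber_le_of_card_le G hv hSle
  set a : ℝ := α * Real.logb 2 n with ha
  have hlogb0 : 0 ≤ Real.logb 2 n := Real.logb_nonneg one_lt_two h1n
  have ha0 : 0 ≤ a := mul_nonneg (Nat.cast_nonneg _) hlogb0
  have hC := sum_pr_liuPassDist_div_card_le H ℓ (n := n) (m := m) hS G
    (fun s hs => hlen s (hSlen s hs)) hcoin (liuPassKt U t) hlow ha0 hX hent
  have hpowbound : (2 : ℝ) ^ (a + 1 - n) * 2 ^ m ≤ 2 * (n : ℝ) ^ (α + γ) := by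
    have e1 : (2 : ℝ) ^ (a + 1 - n) = 2 ^ a * 2 / 2 ^ n := by
      rw [Real.rpow_sub two_pos, Real.rpow_add two_pos, Real.rpow_one, Real.rpow_natCast]
    have e2 : (2 : ℝ) ^ a = (n : ℝ) ^ α := two_rpow_natCast_mul_logb α hn0
    have e3 : (2 : ℝ) ^ m = 2 ^ n * 2 ^ (m - n) := by
      rw [← pow_add]
      congr 1
      omega
    have e4 : (2 : ℝ) ^ (m - n) ≤ (n : ℝ) ^ γ := by
      have hle : m - n ≤ γ * L := by omega
      calc (2 : ℝ) ^ (m - n) ≤ 2 ^ (γ * L) := pow_le_pow_right₀ one_le_two hle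
        _ = (2 ^ L) ^ γ := by rw [mul_comm, pow_mul]
        _ ≤ (n : ℝ) ^ γ := by
            gcongr
            exact_mod_cast h2L
    rw [e1, e2, e3]
    have h2n : (0 : ℝ) < 2 ^ n := by positivity
    calc (n : ℝ) ^ α * 2 / 2 ^ n * (2 ^ n * 2 ^ (m - n)) = 2 * (n : ℝ) ^ α * 2 ^ (m - n) := by
          field_simp
      _ ≤ 2 * (n : ℝ) ^ α * (n : ℝ) ^ γ := by gcongr
      _ = 2 * (n : ℝ) ^ (α + γ) := by rw [pow_add]; ring
  have hfailP : 1 - avgSuccessProb (liuPassKt U t) H m < 1 / P := by linarith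
  have h1mavg : 0 ≤ 1 - avgSuccessProb (liuPassKt U t) H m :=
    sub_nonneg.2 (avgSuccessProb_le_one _ _ _)
  have hnαγ : (0 : ℝ) < 2 * (n : ℝ) ^ (α + γ) := by positivity
  have hPrY : (acceptPMF D n ((condUniform S).map G) true).toReal < a / (a + 1) + 2 / (n : ℝ) ^ 3 := by
    rw [toReal_acceptPMF_condUniform_map D n hS G]
    calc (∑ s ∈ S, D.pr id (boolPair (unaryEncodeNat n) (G s)) {true}) / S.card
        ≤ a / (a + 1) + (2 : ℝ) ^ (a + 1 - n) * (2 ^ m * (1 - avgSuccessProb (liuPassKt U t) H m)) := hC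
      _ = a / (a + 1) + ((2 : ℝ) ^ (a + 1 - n) * 2 ^ m) * (1 - avgSuccessProb (liuPassKt U t) H m) := by
          ring
      _ ≤ a / (a + 1) + (2 * (n : ℝ) ^ (α + γ)) * (1 - avgSuccessProb (liuPassKt U t) H m) := by
          gcongr
      _ < a / (a + 1) + (2 * (n : ℝ) ^ (α + γ)) * (1 / P) := by gcongr
      _ ≤ a / (a + 1) + (2 * (n : ℝ) ^ (α + γ)) * (1 / (n : ℝ) ^ k) := by
          gcongr
      _ = a / (a + 1) + 2 / (n : ℝ) ^ 3 := by
          rw [hk]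
          field_simp
          ring
  -- ### the gap
  have ha1 : a + 1 ≤ ((α : ℝ) + 1) * n := by
    have hlb := logb_two_natCast_le hn0
    calc a + 1 = α * Real.logb 2 n + 1 := rfl
      _ ≤ α * n + n := add_le_add (mul_le_mul_of_nonneg_left hlb (Nat.cast_nonneg α)) h1n
      _ = ((α : ℝ) + 1) * n := by ring
  have hinv : 1 / (((α : ℝ) + 1) * n) ≤ 1 / (a + 1) :=
    one_div_le_one_div_of_le (by linarith) ha1
  have hone : 1 - a / (a + 1) = 1 / (a + 1) := by
    field_simp
    ring
  have hkey : ((α : ℝ) + 1) * (n + 11) ≤ (n : ℝ) ^ 2 := by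
    have hcast : 12 * ((α : ℝ) + 1) ≤ n := by exact_mod_cast hnα
    have h12 : (n : ℝ) + 11 ≤ 12 * n := by linarith
    calc ((α : ℝ) + 1) * (n + 11) ≤ ((α : ℝ) + 1) * (12 * n) := by gcongr
      _ = (12 * ((α : ℝ) + 1)) * n := by ring
      _ ≤ (n : ℝ) * n := by gcongr
      _ = (n : ℝ) ^ 2 := by ring
  have hfinal : 1 / (n : ℝ) ^ 2 ≤ 1 / (((α : ℝ) + 1) * n) - 11 / (n : ℝ) ^ 3 := by
    have hαn : (0 : ℝ) < ((α : ℝ) + 1) * n := by positivity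
    rw [le_sub_iff_add_le, div_add_div _ _ (by positivity) (by positivity),
      div_le_div_iff₀ (by positivity) hαn]
    have := mul_le_mul_of_nonneg_right hkey hn3.le
    nlinarith [this]
  refine le_abs.2 (Or.inr ?_)
  have e8 : (8 : ℝ) / (n : ℝ) ^ 3 = 8 * (1 / (n : ℝ) ^ 3) := by ring
  have e2 : (2 : ℝ) / (n : ℝ) ^ 3 = 2 * (1 / (n : ℝ) ^ 3) := by ring
  have e11 : (11 : ℝ) / (n : ℝ) ^ 3 = 11 * (1 / (n : ℝ) ^ 3) := by ring
  linarith [hPrU, hPrY, hP3, hinv, hone, hfinal, e8, e2, e11]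

end OneLength

/-! ### Thm 5.2 assembled: from a covering family of cond EP-PRGs to mild average-case hardness -/

section Main

variable {U : UniversalMachine} {t : Polynomial ℕ}

/-- `⌊log₂ (k+1)⌋ ≤ ⌊log₂ k⌋ + 1`. [folklore] -/
theorem log_two_succ_le (k : ℕ) : Nat.log 2 (k + 1) ≤ Nat.log 2 k + 1 := by
  have h : k + 1 ≤ 2 ^ (Nat.log 2 k + 1) := Nat.lt_pow_succ_log_self one_lt_two k
  calc Nat.log 2 (k + 1) ≤ Nat.log 2 (2 ^ (Nat.log 2 k + 1)) := Nat.log_mono_right h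
    _ = Nat.log 2 k + 1 := Nat.log_pow one_lt_two _

/-- **The output lengths `m(n) - c`, `c ≤ γ + 1`, cover every length** (Liu–Pass, proof of
Thm 5.2: "Since `m'(n+1) - m'(n) ≤ γ + 1`, there must exist some constant `c ≤ γ + 1` such that `ℋ`
succeeds … for infinitely many `m` of the form `m = n + γ log n - c`"): every `m` is of the form
`n + γ⌊log₂ n⌋ - c` with `c ≤ γ + 1`. [Y. Liu, R. Pass, FOCS 2020, proof of Thm 5.2;
arXiv:2009.11514, §5.2] [cite: LiuPassFOCS2020, Thm 5.2 (proof)] -/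
theorem exists_length_eq_trunc (γ m : ℕ) : ∃ c ≤ γ + 1, ∃ n, n + γ * Nat.log 2 n - c = m := by
  classical
  have hex : ∃ n, m ≤ n + γ * Nat.log 2 n := ⟨m, Nat.le_add_right _ _⟩
  rcases hN : Nat.find hex with _ | k
  · have h0 : m ≤ 0 + γ * Nat.log 2 0 := hN ▸ Nat.find_spec hex
    refine ⟨0, Nat.zero_le _, 0, ?_⟩
    simp only [Nat.log_zero_right, mul_zero, add_zero] at h0 ⊢
    omega
  · have hk1 : m ≤ (k + 1) + γ * Nat.log 2 (k + 1) := hN ▸ Nat.find_spec hex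
    have hk : ¬ m ≤ k + γ * Nat.log 2 k := Nat.find_min hex (hN ▸ k.lt_succ_self)
    have hlog : γ * Nat.log 2 (k + 1) ≤ γ * Nat.log 2 k + γ := by
      have := Nat.mul_le_mul_left γ (log_two_succ_le k)
      rwa [Nat.mul_succ] at this
    refine ⟨(k + 1) + γ * Nat.log 2 (k + 1) - m, by omega, k + 1, ?_⟩
    omega

/-- **Liu–Pass 2020, Thm 5.2 (average-case `K^t`-hardness from cond EP-PRGs), in the tree's
model.** Let `U` be an efficient universal machine and `t` a polynomial budget with `K^t` finite
on all long strings (e.g. `t(n) ≥ (1+ε)n`, `UniversalMachine.kt_lt_top_of_le`). Suppose there is a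
finite family `(G_c, E_c, ℓ_c)_{c ≤ C}` of `1/n²`-cond EP-PRGs (Def 5.1, `IsCondEPPRG`, common
entropy-loss constant `α`) whose output lengths `ℓ_c` are monotone, satisfy
`n ≤ ℓ_c(n) ≤ n + γ⌊log₂ n⌋` (eventually, resp. always) and together cover all large `m` (print:
`G_c = G^c`, the rate-1 cond EP-PRG `G' : {0,1}^n → {0,1}^{n + γ log n}` with the last `c ≤ γ + 1`
bits truncated), and whose outputs have low `K^t`-complexity, `K^t(G_c(s)) + 3⌊log₂ n⌋ < ℓ_c(n)`
for all `n`-bit seeds `s`, `n` large (print's eq. (2): "`K^t(G(s)) = n + O(1) ≤ m - γ/2 log n`,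
since the running time of `G(s)` is bounded by `t(n)`" — in the tree's model this is the one
place where the universal machine's simulation convention enters, so it is kept as a hypothesis).
Then `K^t` is mildly hard-on-average: with `p(m) = m^{α+γ+3} + 1`, every PPT heuristic `ℋ` has
`Pr_{x ← U_m}[ℋ(x) = K^t(x)] ≤ 1 - 1/p(m)` for all large `m`. Proof as in print: if `ℋ` beats
`1 - 1/p(m)` infinitely often then, by pigeonhole over `c` (`exists_length_eq_trunc`), infinitely
often at lengths `m = ℓ_c(n)` for one `c`; there the distinguisher `𝒜_ℋ` (`liuPassDist`, PPT by
the efficiency fact `liuPassDistRun_polyTime`) has advantage `≥ 1/n²` between `G_c(U_n | E_n)`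
and `U_m` (`inv_sq_le_advantage`: Claims 1 and 2), contradicting `1/n²`-pseudorandomness.
[Y. Liu, R. Pass, FOCS 2020, Thm 5.2 and its proof; arXiv:2009.11514, §5.2]
[cite: LiuPassFOCS2020, Thm 5.2] -/
theorem isMildlyHardOnAverage_liuPassKt_of_family (hD : liuPassDistRun_polyTime)
    {γ α C : ℕ} (G : ℕ → List Bool → List Bool) (E : ℕ → ℕ → Finset (List Bool))
    (ℓ : ℕ → ℕ → ℕ)
    (hG : ∀ c ≤ C, IsCondEPPRG (fun n : ℕ => 1 / (n : ℝ) ^ 2) (G c) (E c) (ℓ c) α)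
    (hℓlo : ∀ c ≤ C, ∀ᶠ n in atTop, n ≤ ℓ c n) (hℓhi : ∀ c ≤ C, ∀ n, ℓ c n ≤ n + γ * Nat.log 2 n)
    (hℓmono : ∀ c ≤ C, Monotone (ℓ c))
    (hcover : ∀ᶠ m in atTop, ∃ c ≤ C, ∃ n, ℓ c n = m)
    (hK : ∀ c ≤ C, ∀ᶠ n in atTop, ∀ s : List Bool, s.length = n →
      liuPassKt U t (G c s) + 3 * Nat.log 2 n < ℓ c n)
    (hfin : ∃ n₀, ∀ x : List Bool, n₀ ≤ x.length → U.ktAt (t.eval x.length) x < ⊤) :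
    IsMildlyHardOnAverage encodeNat (liuPassKt U t) := by
  classical
  have hpe : ∀ m : ℕ, (Polynomial.X ^ (α + γ + 3) + 1 : Polynomial ℕ).eval m = m ^ (α + γ + 3) + 1 :=
    fun m => by simp
  refine ⟨Polynomial.X ^ (α + γ + 3) + 1, fun n => by rw [hpe]; positivity, fun H hH => ?_⟩
  -- suppose not: `ℋ` beats `1 - 1/p(m)` for infinitely many `m`
  by_contra hnot
  have hfreq : ∃ᶠ m in atTop, 1 - 1 / (((m ^ (α + γ + 3) + 1 : ℕ) : ℝ)) <
      avgSuccessProb (liuPassKt U t) H m := by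
    rw [Filter.not_eventually] at hnot
    refine hnot.mono fun m hm => ?_
    rw [hpe] at hm
    exact not_le.1 hm
  -- pigeonhole over the finitely many members of the family
  have hfreq' : ∃ᶠ m in atTop, ∃ c ∈ Finset.range (C + 1), ∃ n, ℓ c n = m ∧
      1 - 1 / (((m ^ (α + γ + 3) + 1 : ℕ) : ℝ)) < avgSuccessProb (liuPassKt U t) H m := by
    refine (hfreq.and_eventually hcover).mono ?_
    rintro m ⟨hm, c, hc, n, hn⟩
    exact ⟨c, Finset.mem_range.2 (Nat.lt_succ_of_le hc), n, hn, hm⟩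
  rw [Finset.frequently_exists] at hfreq'
  obtain ⟨c, hc, hfreqc⟩ := hfreq'
  have hcC : c ≤ C := Nat.lt_succ_iff.1 (Finset.mem_range.1 hc)
  -- from "infinitely many `m = ℓ_c(n)`" to "infinitely many `n`" (`ℓ_c(n) ≤ (γ+1) n`)
  have hfreqn : ∃ᶠ n in atTop, 1 - 1 / ((((ℓ c n) ^ (α + γ + 3) + 1 : ℕ) : ℝ)) <
      avgSuccessProb (liuPassKt U t) H (ℓ c n) := by
    rw [Filter.frequently_atTop] at hfreqc ⊢
    intro N₀
    obtain ⟨m, hm, n, hn, hgood⟩ := hfreqc ((γ + 1) * N₀)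
    subst hn
    refine ⟨n, ?_, hgood⟩
    have h1 : ℓ c n ≤ (γ + 1) * n :=
      calc ℓ c n ≤ n + γ * Nat.log 2 n := hℓhi c hcC n
        _ ≤ n + γ * n := Nat.add_le_add_left (Nat.mul_le_mul_left γ (Nat.log_le_self 2 n)) n
        _ = (γ + 1) * n := by ring
    exact Nat.le_of_mul_le_mul_left (hm.trans h1) (Nat.succ_pos γ)
  -- the distinguisher, and pseudorandomness of `G_c` against it
  have hGc := hG c hcC
  have hDppt : IsPPT (liuPassDist H (ℓ c)) encodeBool := isPPT_liuPassDist hD hH (ℓ c)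
  have hpr := hGc.pseudorandom hDppt
  obtain ⟨n₀, hn₀⟩ := hfin
  -- at every large `n` where `ℋ` is good, the advantage is at least `1/n²`
  have hev : ∀ᶠ n in atTop,
      1 - 1 / ((((ℓ c n) ^ (α + γ + 3) + 1 : ℕ) : ℝ)) < avgSuccessProb (liuPassKt U t) H (ℓ c n) →
        1 / (n : ℝ) ^ 2 ≤
          distAdvantage (liuPassDist H (ℓ c)) (condEnsemble (G c) (E c)) (uniformEnsemble (ℓ c)) n := by
    filter_upwards [eventually_ge_atTop 16, eventually_ge_atTop (12 * (α + 1)), eventually_ge_atTop n₀,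
      hℓlo c hcC, hGc.length_out, hGc.entropy, hK c hcC] with n hn16 hnα hnn₀ hlo hlen hent hKn hgood
    have hcoin : (liuPassDist H (ℓ c)).coinLen (2 * n + 2 + ℓ c n) = H.coinLen (ℓ c n) :=
      liuPassDist_coinLen H fun n' hn' => by
        have := hℓmono c hcC hn'.le
        omega
    exact inv_sq_le_advantage H (ℓ c) hlo (hℓhi c hcC n) hn16 hnα hnn₀ (hGc.nonempty n)
      (fun s hs => hGc.length_eq hs) (G c) hlen hent hcoin
      (fun s hs => hKn s (hGc.length_eq hs)) hn₀ hgood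
  -- contradiction with `1/n²`-pseudorandomness
  obtain ⟨n, ⟨hgood, himp⟩, hlt⟩ := ((hfreqn.and_eventually hev).and_eventually hpr).exists
  exact absurd (himp hgood) (not_le.2 hlt)

/-! ### The pass-through mechanism behind eq. (2) for the tree's universal machine -/

/-- **How print's eq. (2) is realised for an abstract `U`.** If a stack machine `M` computes
`hdr(|s|) ‖ s ‖ σ ↦ F(s) ‖ σ` within `T(|s|)` steps *whatever the pass-through block `σ`* (a
`k₀ = k₁` machine that pops the self-delimiting header and `s`, computes `F(s)` on work stacks and
pushes it back on top of the untouched `σ` — the form `G_γ(s₀ ‖ s₁) = s₀ ‖ G'(s₁)` of the padded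
generator of Thm 5.6, mirrored to the stack order), then with `e, p` the code and overhead of `M`
(`UniversalMachine.sim`), `K^{t}(F(s) ‖ σ) ≤ |hdr(|s|)| + |s| + |σ| + 2|e| + 2` at every budget
`t ≥ p(T(|s|))` — in particular at `t(m)`, `m = |F(s) ‖ σ| ≥ |σ|`, as soon as `|σ| ≥ p(T(|s|))` and
`t(m) ≥ m`. With `|hdr(n)| = O(log n)` and `|F(s)| = |s| + γ' log |s|` this is print's
"`K^t(G(s)) = n + O(1) ≤ m - γ/2 log n`" (proof of Thm 5.2, eq. (2)) up to the `O(log n)` header,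
which a larger `γ'` absorbs. From `UniversalMachine.exists_ktAt_le_of_outputsWithin` and
`UniversalMachine.ktAt_anti`. [Y. Liu, R. Pass, FOCS 2020, proof of Thm 5.2 (eq. (2)) and proof of
Thm 5.6 (padding); §2.2] [cite: LiuPassFOCS2020, Thm 5.2 (proof, eq. (2)); Thm 5.6 (proof)] -/
theorem _root_.Literature.Computability.MetaComplexity.UniversalMachine.exists_ktAt_passThrough_le (U : UniversalMachine)
    (M : Turing.TM2ComputableAux Bool Bool) (F : List Bool → List Bool) (hdr : ℕ → List Bool)
    (T : ℕ → ℕ)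
    (hM : ∀ s σ : List Bool, M.OutputsWithin (hdr s.length ++ s ++ σ) (F s ++ σ) (T s.length)) :
    ∃ (e : List Bool) (p : Polynomial ℕ), ∀ (s σ : List Bool) (t : ℕ), p.eval (T s.length) ≤ t →
      U.ktAt t (F s ++ σ) ≤ (hdr s.length).length + s.length + σ.length + (2 * e.length + 2) := by
  obtain ⟨e, p, h⟩ := U.exists_ktAt_le_of_outputsWithin M
  refine ⟨e, p, fun s σ t ht => (U.ktAt_anti ht _).trans ((h _ _ _ (hM s σ)).trans_eq ?_)⟩
  simp only [List.length_append]
  push_cast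
  ring

/-! ### From one-way functions: the §5.3 input as a named fact, and the forward direction of S02 -/

/-- **Liu–Pass 2020, what the proof of Thm 5.2 takes from §5.3 and §2.2, in the tree's model**
(named fact, D-0014). Assume one-way functions exist, and fix an efficient universal machine `U`
and a polynomial budget `t(n) ≥ (1+ε)n`. Then for some `γ > 1` and entropy-loss constant `α`
there are generators `G_c` with events `E_c`, `c ≤ γ + 1`, such that
* each `G_c` is a `1/n²`-cond EP-PRG `{0,1}^n → {0,1}^{n + γ⌊log₂ n⌋ - c}` (Def 5.1) — print:
  Thm 5.6 ("Assume that one way functions exist. Then, for every `γ > 1`, there exists a rate-1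
  efficient `μ`-cond EP-PRG `G_γ : {0,1}^n → {0,1}^{n + γ log n}`, where `μ(n) = 1/n²`") together
  with the first paragraph of the proof of Thm 5.2 ("let `G^c(x)` be a function that computes
  `G'(x)` and truncates the last `c` bits. It directly follows that `G^c` is also a rate-1
  efficient `μ`-cond EP-PRG"); one entropy-loss constant serves the finitely many `G^c` by
  monotonicity in `α` (`IsCondEPPRG.mono`);
* the outputs have low `K^t`-complexity: `K^t(G_c(s)) + 3⌊log₂ n⌋ < n + γ⌊log₂ n⌋ - c` for all
  `n`-bit `s`, `n` large — print's eq. (2) of the proof of Thm 5.2 ("`K^t(G(s)) = n + O(1) =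
  (m - γ log n + c) + O(1) ≤ m - γ/2 log n` for sufficiently large `n`", `γ ≥ 8`, "since the
  running time of `G(s)` is bounded by `t(|s|) = t(n) ≤ t(m)`").
In print eq. (2) rests on the rate-1 efficiency of `G_γ` and the convention of §2.2 that the budget
of `U(Π, 1^t)` counts the emulated machine's steps. For the tree's `UniversalMachine` (universality
with a polynomial simulation overhead `p`, budgets counting `U`-steps, `UniversalMachine.sim`) the
same bound is obtained from the *form* of the generator of Thm 5.6, `G_γ(s₀ ‖ s₁) = s₀ ‖ G'(s₁)`
with `G'` the cond EP-PRG of Thm 5.5 (one algorithm with parameters `γ, δ`, "running time bounded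
by `(γ+δ) t₀(n)`") applied to a block `s₁` short enough that `p` of its running time is at most
`|s₀| ≤ m ≤ t(m)`, the pass-through block `s₀` being copied at no cost in the budget
(`UniversalMachine.exists_ktAt_le_of_outputsWithin`); this is why the fact is stated for the given
`U` and `t`. Not proved here: it packages the HILL/Goldreich–Levin-type construction of §5.3
(Lemmas 5.3–5.4, Thms 5.5–5.6 and Appendix) and routine TM2 programming.
[Y. Liu, R. Pass, FOCS 2020, Thm 5.6, Thm 5.5, and proof of Thm 5.2 (¶1 and eq. (2));
arXiv:2009.11514, §5.2–5.3] [cite: LiuPassFOCS2020, Thm 5.6; Thm 5.2 (proof, ¶1 and eq. (2))] -/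
def condEPPRG_family_of_OWFExist : Prop :=
  OWFExist → ∀ (U : UniversalMachine) (t : Polynomial ℕ) {ε : ℝ} (_hε : 0 < ε)
    (_ht : ∀ n : ℕ, (1 + ε) * n ≤ ((t.eval n : ℕ) : ℝ)),
    ∃ (γ α : ℕ) (G : ℕ → List Bool → List Bool) (E : ℕ → ℕ → Finset (List Bool)), 2 ≤ γ ∧
      (∀ c ≤ γ + 1, IsCondEPPRG (fun n : ℕ => 1 / (n : ℝ) ^ 2) (G c) (E c)
        (fun n => n + γ * Nat.log 2 n - c) α) ∧
      (∀ c ≤ γ + 1, ∀ᶠ n in atTop, ∀ s : List Bool, s.length = n →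
        liuPassKt U t (G c s) + 3 * Nat.log 2 n < n + γ * Nat.log 2 n - c)

/-- **S02, direction `→`, for every `U` and every polynomial `t(n) ≥ (1+ε)n`** (Liu–Pass 2020,
Thm 3.1 (a) ⇒ (c) specialised to exact computation, i.e. the remark after Thm 3.1: "for every
polynomial `t(n) ≥ (1+ε)n` … mild average-case hardness of `K^t` is equivalent to the existence of
one-way functions"): if one-way functions exist then `K^t` is mildly hard-on-average. From the
§5.3 fact `condEPPRG_family_of_OWFExist`, the efficiency fact `liuPassDistRun_polyTime`, and the
theorem `isMildlyHardOnAverage_liuPassKt_of_family` (Thm 5.2), the covering of all lengths being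
`exists_length_eq_trunc` and the finiteness of `K^t` being `UniversalMachine.kt_lt_top_of_le`.
[Y. Liu, R. Pass, FOCS 2020, Thm 3.1 (a) ⇒ (c) and the remark following it (p. 9 of
arXiv:2009.11514v1); Thm 5.2] [cite: LiuPassFOCS2020, Thm 3.1 (a)⇒(c) and remark; Thm 5.2] -/
theorem isMildlyHardOnAverage_liuPassKt_of_OWFExist_of (h₅ : condEPPRG_family_of_OWFExist)
    (hD : liuPassDistRun_polyTime) (U : UniversalMachine) (t : Polynomial ℕ) {ε : ℝ} (hε : 0 < ε)
    (ht : ∀ n : ℕ, (1 + ε) * n ≤ ((t.eval n : ℕ) : ℝ)) (hO : OWFExist) :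
    IsMildlyHardOnAverage encodeNat (liuPassKt U t) := by
  obtain ⟨γ, α, G, E, hγ, hG, hK⟩ := h₅ hO U t hε ht
  obtain ⟨n₁, hn₁⟩ := U.kt_lt_top_of_le hε
  refine isMildlyHardOnAverage_liuPassKt_of_family hD (C := γ + 1) G E
    (fun c n => n + γ * Nat.log 2 n - c) hG ?_ (fun c _ n => Nat.sub_le _ _) ?_
    (Filter.Eventually.of_forall fun m => exists_length_eq_trunc γ m) hK
    ⟨n₁, fun x hx => hn₁ x hx _ (Nat.ceil_le.2 (ht x.length))⟩
  · intro c hc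
    filter_upwards [eventually_ge_atTop 4] with n hn
    have h2 : 2 ≤ Nat.log 2 n := Nat.le_log_of_pow_le one_lt_two (by omega)
    have h3 := Nat.mul_le_mul_left γ h2
    omega
  · intro c _ a b hab
    exact Nat.sub_le_sub_right (Nat.add_le_add hab (Nat.mul_le_mul_left γ (Nat.log_mono_right hab))) c

/-- **Liu–Pass 2020, Thm 3.1 (a) ⇒ (b)** (the fact `exists_isMildlyHardOnAverage_liuPassKt_of_OWFExist`
of `Sweep1Proofs.lean`), now reduced to the §5.3 fact and the efficiency fact: instantiate the
forward direction at `t = 2X`, `ε = 1`. [Y. Liu, R. Pass, FOCS 2020, Thm 3.1; arXiv:2009.11514]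
[cite: LiuPassFOCS2020, Thm 3.1 (a)⇒(b)] -/
theorem exists_isMildlyHardOnAverage_liuPassKt_of_OWFExist_of (h₅ : condEPPRG_family_of_OWFExist)
    (hD : liuPassDistRun_polyTime) : exists_isMildlyHardOnAverage_liuPassKt_of_OWFExist := by
  intro hO U
  have h2 : ∀ n : ℕ, (1 + (1 : ℝ)) * n ≤ (((2 * Polynomial.X : Polynomial ℕ).eval n : ℕ) : ℝ) := by
    intro n
    simp only [Polynomial.eval_mul, Polynomial.eval_ofNat, Polynomial.eval_X, Nat.cast_mul,
      Nat.cast_ofNat]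
    norm_num
  exact ⟨2 * Polynomial.X, 1, one_pos, h2,
    isMildlyHardOnAverage_liuPassKt_of_OWFExist_of h₅ hD U _ one_pos h2 hO⟩

/-- **crypto-foundations.S02 (Liu–Pass 2020, Thm 1.1 / remark after Thm 3.1) from named facts.**
For every efficient universal machine `U` and every polynomial `t(n) ≥ (1+ε)n`, one-way functions
exist iff `K^t` is mildly hard-on-average — assembled from: the two efficiency facts of Thm 4.1
(`liuPassOWF_polyTimeComputable`, `liuPassHeur_isPPT`; the rest of Thm 4.1 is proved in
`LiuPassWeakOWF.lean`), Yao's amplification (`weakOWFExist_iff_OWFExist`, S05), the §5.3 fact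
`condEPPRG_family_of_OWFExist`, and the efficiency fact `liuPassDistRun_polyTime` (the rest of
Thm 5.2 is proved above). [Y. Liu, R. Pass, FOCS 2020, Thm 1.1, Thm 3.1; arXiv:2009.11514]
[cite: LiuPassFOCS2020, Thm 1.1] -/
theorem OWFExist_iff_isMildlyHardOnAverage_liuPassKt_of_facts
    (hf : liuPassOWF_polyTimeComputable) (hH : liuPassHeur_isPPT) (hYao : weakOWFExist_iff_OWFExist)
    (h₅ : condEPPRG_family_of_OWFExist) (hD : liuPassDistRun_polyTime) :
    OWFExist_iff_isMildlyHardOnAverage_liuPassKt :=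
  OWFExist_iff_isMildlyHardOnAverage_liuPassKt_of
    (weakOWFExist_of_isMildlyHardOnAverage_liuPassKt_of hf hH) hYao
    fun U t _ hε ht hO => isMildlyHardOnAverage_liuPassKt_of_OWFExist_of h₅ hD U t hε ht hO

end Main

end Literature.Computability.Cryptography
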